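import Literature.NumberTheory.Sieve.CFCongruenceTransferSplitting
import Literature.NumberTheory.Sieve.CFCongruenceTransferSmoothing
import Literature.NumberTheory.Sieve.CFSemigroupScalarStrip
import Literature.NumberTheory.Sieve.CFSemigroupCountPowerSaving
import HarnessLib

/-!
# Magee–Oh–Winter uniform congruence counting for `Γ_A` from their Theorem 4

Final support file (all results proved) for the named fact
`Literature.NumberTheory.Sieve.MageeOhWinter2019_uniformCounting` (`CFSemigroupCounting.lean`):
**`MageeOhWinter2019_uniformCounting_of_transferOperatorBounds`** derives the fact from
[MageeOhWinter2019, Thm. 4] ("Bounds for congruence transfer operators") taken VERBATIM as a hypothesis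
— stated in the paper's own setting `C¹(I; ℂ^{Γ_q})` of `CFCongruenceTransferOperator.lean` — combined
with the tree's complete formalisation of the paper's §3 (renewal equation, Laplace inversion with a
power saving, Frobenius-norm bridging: `uniformCounting_of_operatorBounds`, `CFSemigroupCountPowerSaving.lean`).

The proof follows [MageeOhWinter2019, §3.4]: the hypotheses `hL1`, `hL2`, `hBq`, `hopq` of
`uniformCounting_of_operatorBounds` (invertibility of `1 ∓ L_s`, of `1 - B_s` uniformly in `q` coprime to
`Q₀`, and a uniform polynomial bound for the regular part of the twisted resolvent on a vertical strip)
are obtained region by region: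
* `Re s > δ + ε/2`: Neumann series (`isUnit_one_sub_cfTwist_of_lt`, sup part of
  `cfTwist_pow_apply_bounds_gen`) — no input from Theorem 4;
* `|Re s - δ| < ε`, `|Im s| > b₀`: Theorem 4 (2) ⇒ (Steklov smoothing, `CFCongruenceTransferSmoothing`)
  summable operator bounds on piecewise Lipschitz functions ⇒ `1 - 𝓜_s` is a unit for every `q`
  (`isUnit_one_sub_cfTwist_of_bounds`), hence `1 ∓ L_s` (level `1`) and `1 - B_s`; the growth in `|Im s|`
  of the resolvent applied to the `s`-dependent test family is tamed by the `m₀`-splitting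
  (`norm_cfSeries_le_split`: a priori Gibbs head + Theorem-4 tail), giving exponent `κ < 2`;
* `|Re s - δ| < ε`, `|Im s| ≤ b₀`: Theorem 4 (1) for the part orthogonal to constants
  (`isUnit_one_sub_cfTwB_of_bounds`, polynomial in `q`), and the scalar part by the tree's pole/boundary
  analysis plus compactness (`CFSemigroupScalarStrip.lean`).

## References

* [MageeOhWinter2019] M. Magee, H. Oh, D. Winter, J. reine angew. Math. 753 (2019) 89–135: Thm. 1, 2,
  4, 11, §3.4, appendix Thm. 37.
-/

noncomputable section

open Set Filter Metric Complex Real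
open scoped MatrixGroups Topology

namespace Literature.NumberTheory.Sieve

variable {A : Finset ℕ} (hA : ∀ a ∈ A, 1 ≤ a) (h2 : 2 ≤ A.card) (q : ℕ) [NeZero q]

/-! ### `1 - B_s` from `1 - 𝓜_s` -/

section BfromM

/-- **If `1 - 𝓜_s` is a unit then so is `1 - B_s`** (`B_s = 𝓜_s P₁`): the inverse is `P₀ + (1 - 𝓜_s)⁻¹ P₁`
(`P₀, P₁` the complementary projections onto constants / orthogonal to constants, which commute with `𝓜_s`).
[cite: MageeOhWinter2019, §3.4] -/
theorem isUnit_one_sub_cfTwB_of_isUnit {s : ℂ} (h : IsUnit (1 - cfTwist A hA q s)) : IsUnit (1 - cfTwB A hA q s) := by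
  set M := cfTwist A hA q s with hM
  set P1 := cfTwP1 q with hP1
  set P0 := cfTwP0 q with hP0
  set R := Ring.inverse (1 - M) with hR
  obtain ⟨h10, h01, h11⟩ := cfTwP1_mul q
  have hsum : P0 + P1 = 1 := by rw [hP1, cfTwP1]; abel
  have hcomm1 : P1 * M = M * P1 := cfTwP1_comm A hA q s
  have hcomm0 : P0 * M = M * P0 := cfTwP0_comm A hA q s
  have hR1 : (1 - M) * R = 1 := Ring.mul_inverse_cancel _ h
  have hR2 : R * (1 - M) = 1 := Ring.inverse_mul_cancel _ h
  -- `R` commutes with `P₁`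
  have hc : (1 - M) * P1 = P1 * (1 - M) := by rw [sub_mul, mul_sub, one_mul, mul_one, hcomm1]
  have hRP : R * P1 = P1 * R := by
    calc R * P1 = R * P1 * ((1 - M) * R) := by rw [hR1, mul_one]
      _ = R * (P1 * (1 - M)) * R := by simp only [mul_assoc]
      _ = R * ((1 - M) * P1) * R := by rw [hc]
      _ = P1 * R := by rw [← mul_assoc, hR2, one_mul]
  have hB : cfTwB A hA q s = M * P1 := rfl
  refine (Ring.inverse_eq_of_mul_eq_one (a := 1 - cfTwB A hA q s) (b := P0 + R * P1) ?_ ?_).1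
  · rw [hB]
    calc (1 - M * P1) * (P0 + R * P1) = P0 + R * P1 - M * (P1 * P0) - M * (P1 * R) * P1 := by
          simp only [sub_mul, one_mul, mul_add, mul_assoc]; abel
      _ = P0 + R * P1 - M * R * P1 := by rw [h10, mul_zero, sub_zero, ← hRP, ← mul_assoc, mul_assoc (M * R), h11]
      _ = P0 + (1 - M) * R * P1 := by rw [sub_mul, one_mul, sub_mul]; abel
      _ = 1 := by rw [hR1, one_mul, hsum]
  · rw [hB]
    calc (P0 + R * P1) * (1 - M * P1) = P0 + R * P1 - P0 * M * P1 - R * (P1 * M) * P1 := by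
          simp only [mul_sub, mul_one, add_mul, mul_assoc]; abel
      _ = P0 + R * P1 - R * M * P1 := by
          rw [hcomm0, mul_assoc M P0 P1, h01, mul_zero, sub_zero, hcomm1, ← mul_assoc, mul_assoc (R * M), h11]
      _ = P0 + R * (1 - M) * P1 := by rw [mul_sub, mul_one, sub_mul]; abel
      _ = 1 := by rw [hR2, one_mul, hsum]

end BfromM

/-! ### The Neumann region `Re s > δ_A` -/

section Neumann

include h2 in
/-- **Componentwise bound for the Neumann inverse:** for `Re s > δ_A`,
`|((1 - 𝓜_s)⁻¹ F)_η(y)| ≤ 4^σ (1 - λ_σ²)⁻¹ ‖F‖` (`σ = Re s`, `λ_σ = e^{P(σ)} < 1`), uniformly in `q` and `Im s`.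
[cite: MageeOhWinter2019, Lemma 15] -/
theorem norm_inverse_one_sub_cfTwist_apply_le {s : ℂ} (hs : cfDimension A < s.re) (F : SL(2, ZMod q) → CfLip)
    (η : SL(2, ZMod q)) (y : Icc (0 : ℝ) 1) :
    ‖(Ring.inverse (1 - cfTwist A hA q s) F) η y‖ ≤ (4 : ℝ) ^ s.re * (1 - cfEig A s.re ^ 2)⁻¹ * ‖F‖ := by
  have hδ := (cfDimension_pos hA h2).le
  have hs0 : 0 ≤ s.re := by linarith
  obtain ⟨hsum, -⟩ := isUnit_one_sub_cfTwist_of_lt A hA h2 q hs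
  have hlam := cfEig_pos (A := A) s.re
  have hlam1 := cfEig_lt_one_of_lt A hA h2 hs
  rw [inverse_one_sub_eq_tsum hsum]
  -- evaluate the operator series at `F`, then at `(η, y)`
  have hsumT : Summable fun n => cfTwist A hA q s ^ n := hsum.of_norm
  have e1 : (∑' n, cfTwist A hA q s ^ n) F = ∑' n, (cfTwist A hA q s ^ n) F :=
    (ContinuousLinearMap.apply ℂ (SL(2, ZMod q) → CfLip) F).map_tsum hsumT
  have hsumF : Summable fun n => (cfTwist A hA q s ^ n) F :=
    (ContinuousLinearMap.apply ℂ (SL(2, ZMod q) → CfLip) F).summable hsumT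
  set E : (SL(2, ZMod q) → CfLip) →L[ℂ] ℂ := (CfLip.eval y).comp (ContinuousLinearMap.proj η) with hE
  have e2 : ((∑' n, (cfTwist A hA q s ^ n) F) η) y = ∑' n, ((cfTwist A hA q s ^ n) F) η y := by
    have := E.map_tsum hsumF
    simpa only [hE, ContinuousLinearMap.coe_comp, Function.comp_apply, ContinuousLinearMap.proj_apply,
      CfLip.eval_apply] using this
  rw [e1, e2]
  have hbd : ∀ n, ‖((cfTwist A hA q s ^ n) F) η y‖ ≤ (4 : ℝ) ^ s.re * ‖F‖ * (cfEig A s.re ^ 2) ^ n := fun n => by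
    have := (cfTwist_pow_apply_bounds_gen A hA h2 q hs0 n F η).1 y
    rw [← pow_mul]; linarith [this]
  have hgeo : HasSum (fun n => (4 : ℝ) ^ s.re * ‖F‖ * (cfEig A s.re ^ 2) ^ n)
      ((4 : ℝ) ^ s.re * ‖F‖ * (1 - cfEig A s.re ^ 2)⁻¹) :=
    (hasSum_geometric_of_lt_one (by positivity) (by nlinarith)).mul_left _
  refine (tsum_of_norm_bounded hgeo hbd).trans (le_of_eq (by ring))

end Neumann

/-! ### An exponential estimate and the test family -/

section TestFamily

/-- `‖e^w - 1‖ ≤ ‖w‖ e^{|Re w|}` (mean value theorem along `t ↦ e^{tw}`). [folklore] -/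
theorem norm_cexp_sub_one_le' (w : ℂ) : ‖Complex.exp w - 1‖ ≤ ‖w‖ * Real.exp |w.re| := by
  have hderiv : ∀ t ∈ Icc (0 : ℝ) 1, HasDerivWithinAt (fun t : ℝ => Complex.exp (t * w)) (w * Complex.exp (t * w)) (Icc 0 1) t := by
    intro t _
    have h1 : HasDerivAt (fun t : ℝ => (t : ℂ) * w) w t := by
      simpa using (Complex.ofRealCLM.hasDerivAt (x := t)).mul_const w
    have := h1.cexp
    rw [mul_comm] at this
    exact this.hasDerivWithinAt
  have hbound : ∀ t ∈ Icc (0 : ℝ) 1, ‖w * Complex.exp (t * w)‖ ≤ ‖w‖ * Real.exp |w.re| := by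
    intro t ht
    rw [norm_mul, Complex.norm_exp]
    refine mul_le_mul_of_nonneg_left (Real.exp_le_exp.2 ?_) (norm_nonneg _)
    have : ((t : ℂ) * w).re = t * w.re := by simp
    rw [this]
    calc t * w.re ≤ |t * w.re| := le_abs_self _
      _ = |t| * |w.re| := abs_mul _ _
      _ ≤ 1 * |w.re| := by gcongr; rw [abs_of_nonneg ht.1]; exact ht.2
      _ = |w.re| := one_mul _
  have h := (convex_Icc (0 : ℝ) 1).norm_image_sub_le_of_norm_hasDerivWithin_le hderiv hbound
    (left_mem_Icc.2 zero_le_one) (right_mem_Icc.2 zero_le_one)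
  simp only [Complex.ofReal_one, one_mul, Complex.ofReal_zero, zero_mul, Complex.exp_zero, sub_zero, Real.norm_eq_abs,
    abs_one, mul_one] at h
  exact h

variable {q}

/-- **The test function `G_s = Φ₀^{-2s}`:** `|G_s(y)| ≤ 1` and `G_s` is `2‖s‖e^{2σ}`-Lipschitz on `[0,1]`
for `σ = Re s ≥ 0` (`Φ₀ = √(1+y²) ∈ [1, 2]`, `log Φ₀` is `1`-Lipschitz and `≤ 1`). [cite: MageeOhWinter2019, §3.2] -/
theorem cfPowFam_one_bounds {s : ℂ} (hs : 0 ≤ s.re) :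
    (∀ y : Icc (0 : ℝ) 1, ‖cfΘ₀.cfPowFam (CfLip.const 1) 2 s y‖ ≤ 1) ∧
    (∀ x y : Icc (0 : ℝ) 1, ‖cfΘ₀.cfPowFam (CfLip.const 1) 2 s x - cfΘ₀.cfPowFam (CfLip.const 1) 2 s y‖ ≤
      2 * ‖s‖ * Real.exp (2 * s.re) * |(x : ℝ) - y|) := by
  have hval : ∀ y : Icc (0 : ℝ) 1, cfΘ₀.cfPowFam (CfLip.const 1) 2 s y = Complex.exp (-((2 : ℂ) * s * Real.log (cfΘ₀.Φ y))) := by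
    intro y
    rw [CfThreshold.cfPowFam, CfLip.mul_apply, CfLip.const_apply, one_mul, CfThreshold.cfPow_apply]
    push_cast; ring_nf
  have hre : ∀ y : Icc (0 : ℝ) 1, (-((2 : ℂ) * s * Real.log (cfΘ₀.Φ y))).re = -(2 * s.re * Real.log (cfΘ₀.Φ y)) := by
    intro y; simp [Complex.mul_re]
  have hnorm : ∀ y : Icc (0 : ℝ) 1, ‖cfΘ₀.cfPowFam (CfLip.const 1) 2 s y‖ ≤ 1 := fun y => by
    rw [hval, Complex.norm_exp, hre]
    refine Real.exp_le_one_iff.2 ?_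
    have := cfΘ₀.log_nonneg y.2
    nlinarith
  refine ⟨hnorm, fun x y => ?_⟩
  have hLx := cfΘ₀.log_nonneg x.2
  have hLy := cfΘ₀.log_nonneg y.2
  have hΛx : Real.log (cfΘ₀.Φ x) ≤ 1 := cfΘ₀.log_le x x.2
  have hΛy : Real.log (cfΘ₀.Φ y) ≤ 1 := cfΘ₀.log_le y y.2
  have hlip : |Real.log (cfΘ₀.Φ x) - Real.log (cfΘ₀.Φ y)| ≤ 1 * |(x : ℝ) - y| := cfΘ₀.abs_log_sub_le x.2 y.2
  rw [one_mul] at hlip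
  -- `e^{-2s ℓx} - e^{-2s ℓy} = e^{-2s ℓy} (e^{-2s(ℓx - ℓy)} - 1)`
  set ℓx := Real.log (cfΘ₀.Φ x) with hℓx
  set ℓy := Real.log (cfΘ₀.Φ y) with hℓy
  set w : ℂ := -((2 : ℂ) * s * ((ℓx - ℓy : ℝ) : ℂ)) with hw
  have hfac : cfΘ₀.cfPowFam (CfLip.const 1) 2 s x - cfΘ₀.cfPowFam (CfLip.const 1) 2 s y =
      cfΘ₀.cfPowFam (CfLip.const 1) 2 s y * (Complex.exp w - 1) := by
    rw [mul_sub, mul_one, hval x, hval y, ← Complex.exp_add]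
    congr 2
    rw [hw]; push_cast; ring
  rw [hfac, norm_mul]
  have hw1 : ‖w‖ = 2 * ‖s‖ * |ℓx - ℓy| := by
    rw [hw, norm_neg, norm_mul, norm_mul, Complex.norm_real, Real.norm_eq_abs, Complex.norm_two]
  have hw2 : |w.re| ≤ 2 * s.re := by
    have : w.re = -(2 * s.re * (ℓx - ℓy)) := by rw [hw]; simp [Complex.mul_re]
    rw [this, abs_neg, abs_mul, abs_of_nonneg (by positivity : (0:ℝ) ≤ 2 * s.re)]
    have hd : |ℓx - ℓy| ≤ 1 := by rw [abs_le]; constructor <;> linarith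
    nlinarith
  calc ‖cfΘ₀.cfPowFam (CfLip.const 1) 2 s y‖ * ‖Complex.exp w - 1‖ ≤ 1 * (‖w‖ * Real.exp |w.re|) :=
        mul_le_mul (hnorm y) (norm_cexp_sub_one_le' w) (norm_nonneg _) zero_le_one
    _ ≤ 2 * ‖s‖ * |(x : ℝ) - y| * Real.exp (2 * s.re) := by
        rw [one_mul, hw1]
        gcongr
    _ = 2 * ‖s‖ * Real.exp (2 * s.re) * |(x : ℝ) - y| := by ring

omit [NeZero q] in
/-- **The test family** `F_s = G_s ⊗ δ_1` (`cfFamS q cfΘ₀ 1 1 s`): components bounded by `1` and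
`2‖s‖e^{2σ}`-Lipschitz. [cite: MageeOhWinter2019, §3.2] -/
theorem cfFamS_one_bounds {s : ℂ} (hs : 0 ≤ s.re) :
    (∀ (η : SL(2, ZMod q)) (y : Icc (0 : ℝ) 1), ‖cfFamS q cfΘ₀ (CfLip.const 1) 1 s η y‖ ≤ 1) ∧
    (∀ (η : SL(2, ZMod q)) (x y : Icc (0 : ℝ) 1), ‖cfFamS q cfΘ₀ (CfLip.const 1) 1 s η x - cfFamS q cfΘ₀ (CfLip.const 1) 1 s η y‖ ≤
      2 * ‖s‖ * Real.exp (2 * s.re) * |(x : ℝ) - y|) := by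
  obtain ⟨h1, h2'⟩ := cfPowFam_one_bounds hs
  refine ⟨fun η y => ?_, fun η x y => ?_⟩
  · rw [cfFamS, cfTwSingle_apply]
    split_ifs
    · exact h1 y
    · simp
  · rw [cfFamS, cfTwSingle_apply]
    split_ifs
    · exact h2' x y
    · simp only [CfLip.zero_apply, sub_zero, norm_zero]; positivity

/-- Norm of the test family in `Γ_q → CfLip`: `‖F_s‖ ≤ 1 + 2‖s‖e^{2σ}`. [cite: MageeOhWinter2019, §3.2] -/
theorem norm_cfFamS_one_le {s : ℂ} (hs : 0 ≤ s.re) :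
    ‖cfFamS q cfΘ₀ (CfLip.const 1) 1 s‖ ≤ 1 + 2 * ‖s‖ * Real.exp (2 * s.re) := by
  obtain ⟨h1, h2'⟩ := cfFamS_one_bounds (q := q) hs
  have hpos : 0 ≤ 1 + 2 * ‖s‖ * Real.exp (2 * s.re) := by positivity
  rw [pi_norm_le_iff_of_nonneg hpos]
  intro η
  exact CfLip.norm_le_of_bounds (by positivity) (h1 η) (h2' η)

/-- The projection `P₁ F_s` onto the part orthogonal to constants: components bounded by `2` and
`2 · 2‖s‖e^{2σ}`-Lipschitz, and `Σ_ξ (P₁F_s)_ξ = 0`. [cite: MageeOhWinter2019, §3.4] -/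
theorem cfTwP1_cfFamS_bounds {s : ℂ} (hs : 0 ≤ s.re) :
    (∀ (η : SL(2, ZMod q)) (y : Icc (0 : ℝ) 1), ‖cfTwP1 q (cfFamS q cfΘ₀ (CfLip.const 1) 1 s) η y‖ ≤ 2) ∧
    (∀ (η : SL(2, ZMod q)) (x y : Icc (0 : ℝ) 1),
      ‖cfTwP1 q (cfFamS q cfΘ₀ (CfLip.const 1) 1 s) η x - cfTwP1 q (cfFamS q cfΘ₀ (CfLip.const 1) 1 s) η y‖ ≤
        2 * (2 * ‖s‖ * Real.exp (2 * s.re)) * |(x : ℝ) - y|) := by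
  set F := cfFamS q cfΘ₀ (CfLip.const 1) 1 s with hF
  set G := cfΘ₀.cfPowFam (CfLip.const 1) 2 s with hG
  set N : ℂ := (Fintype.card (SL(2, ZMod q)) : ℂ) with hN
  obtain ⟨g1, g2⟩ := cfPowFam_one_bounds hs
  obtain ⟨f1, f2⟩ := cfFamS_one_bounds (q := q) hs
  have hAv : cfTwAv q F = N⁻¹ • G := by rw [hF, cfFamS, cfTwAv_cfTwSingle]
  have hcard : ‖N⁻¹‖ ≤ 1 := by
    rw [norm_inv, hN, Complex.norm_natCast]
    exact inv_le_one_of_one_le₀ (by exact_mod_cast Fintype.card_pos)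
  refine ⟨fun η y => ?_, fun η x y => ?_⟩
  · rw [cfTwP1_apply', CfLip.sub_apply, hAv, CfLip.smul_apply]
    calc ‖F η y - N⁻¹ * G y‖ ≤ ‖F η y‖ + ‖N⁻¹ * G y‖ := norm_sub_le _ _
      _ ≤ 1 + 1 * 1 := by rw [norm_mul]; exact add_le_add (f1 η y) (mul_le_mul hcard (g1 y) (norm_nonneg _) zero_le_one)
      _ = 2 := by norm_num
  · rw [cfTwP1_apply', CfLip.sub_apply, CfLip.sub_apply, hAv, CfLip.smul_apply, CfLip.smul_apply]
    have e : F η x - N⁻¹ * G x - (F η y - N⁻¹ * G y) = (F η x - F η y) - N⁻¹ * (G x - G y) := by ring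
    rw [e]
    calc ‖(F η x - F η y) - N⁻¹ * (G x - G y)‖ ≤ ‖F η x - F η y‖ + ‖N⁻¹ * (G x - G y)‖ := norm_sub_le _ _
      _ ≤ 2 * ‖s‖ * Real.exp (2 * s.re) * |(x : ℝ) - y| + 1 * (2 * ‖s‖ * Real.exp (2 * s.re) * |(x : ℝ) - y|) := by
          rw [norm_mul]
          exact add_le_add (f2 η x y) (mul_le_mul hcard (g2 x y) (norm_nonneg _) zero_le_one)
      _ = 2 * (2 * ‖s‖ * Real.exp (2 * s.re)) * |(x : ℝ) - y| := by ring

end TestFamily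

/-! ### From Theorem 4 (as printed) to summable operator bounds on piecewise Lipschitz functions -/

section Glue

variable {q}

include hA in
/-- **Theorem 4 (2) ⇒ unweighted operator bounds, any `q`.** If for `s = a + ib` the iterates satisfy
`‖𝓛^m F‖_{C¹(I)} ≤ C_η |b|² ρ_η^m ‖F‖_{C¹(I)}` for all `F ∈ C¹(I; ℂ^{Γ_q})` (Theorem 4 (2) with `η = 1`), then
the bounds `hβ` of `CFCongruenceTransferBridge` hold with `θ = 1`, `β_m = C_η|b|²ρ_η^m`, for the trivial
constraint. [cite: MageeOhWinter2019, Thm. 4 (2)] -/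
theorem thm4_large_bounds {a b Cη ρη : ℝ} (hCη : 0 ≤ Cη) (hρη : 0 ≤ ρη)
    (hT : ∀ F : ℝ → CfVec q, ContDiffOn ℝ 1 F (cfI A) → ∀ m : ℕ,
      c1NormOn (cfI A) ((cfCongL A q ((a : ℂ) + b * I))^[m] F) ≤ Cη * |b| ^ (1 + (1 : ℝ)) * ρη ^ m * c1NormOn (cfI A) F) :
    ∀ (m : ℕ) (g : ℝ → CfVec q) (M L : ℝ), 0 ≤ M → 0 ≤ L → (∀ x ∈ cfI A, ‖g x‖ ≤ M) →
      (∀ a₁ ∈ A, ∀ a' ∈ A, ∀ x ∈ cfCyl A a₁ a', ∀ y ∈ cfCyl A a₁ a', ‖g x - g y‖ ≤ L * |x - y|) →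
      (∀ x ∈ cfI A, ‖(cfCongL A q ((a : ℂ) + b * I))^[m] g x‖ ≤ (Cη * |b| ^ (2 : ℝ) * ρη ^ m) * (M + 1 * L)) ∧
      (∀ a₁ ∈ A, ∀ a' ∈ A, ∀ x ∈ cfCyl A a₁ a', ∀ y ∈ cfCyl A a₁ a',
        ‖(cfCongL A q ((a : ℂ) + b * I))^[m] g x - (cfCongL A q ((a : ℂ) + b * I))^[m] g y‖ ≤
          (1 : ℝ)⁻¹ * ((Cη * |b| ^ (2 : ℝ) * ρη ^ m) * (M + 1 * L)) * |x - y|) := by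
  intro m g M L hM hL hgM hgL
  have hB : 0 ≤ Cη * |b| ^ (2 : ℝ) * ρη ^ m := by positivity
  have h12 : (1 : ℝ) + 1 = 2 := by norm_num
  obtain ⟨h1, h2'⟩ := cfCongL_iterate_pLip_of_c1 hA (0 : CfVec q →L[ℝ] ℂ) ((a : ℂ) + b * I) m hB
    (fun F hF _ => by have := hT F hF m; rwa [h12] at this) hM hL hgM hgL (fun x _ => rfl)
  simp only [one_mul, inv_one]
  exact ⟨h1, h2'⟩

include hA in
/-- **Theorem 4 (1) ⇒ unweighted operator bounds on `ℂ^{Γ_q} ⊖ 1`-valued functions.** If for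
`s = a + ib` and the level `q` the iterates satisfy `‖𝓛^m F‖_{C¹(I)} ≤ C q^C ρ₀^m ‖F‖_{C¹(I)}` for all
`F ∈ C¹(I; ℂ^{Γ_q} ⊖ 1)`, then the bounds `hβ` hold with `θ = 1`, `β_m = C q^C ρ₀^m`, under the constraint
`cfSumCoord = 0`. [cite: MageeOhWinter2019, Thm. 4 (1)] -/
theorem thm4_small_bounds {a b C ρ₀ : ℝ} (hC : 0 ≤ C) (hρ₀ : 0 ≤ ρ₀)
    (hT : ∀ F : ℝ → CfVec q, ContDiffOn ℝ 1 F (cfI A) → (∀ x ∈ cfI A, ∑ ξ, F x ξ = 0) → ∀ m : ℕ,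
      c1NormOn (cfI A) ((cfCongL A q ((a : ℂ) + b * I))^[m] F) ≤ C * (q : ℝ) ^ C * ρ₀ ^ m * c1NormOn (cfI A) F) :
    ∀ (m : ℕ) (g : ℝ → CfVec q) (M L : ℝ), 0 ≤ M → 0 ≤ L → (∀ x ∈ cfI A, ‖g x‖ ≤ M) →
      (∀ a₁ ∈ A, ∀ a' ∈ A, ∀ x ∈ cfCyl A a₁ a', ∀ y ∈ cfCyl A a₁ a', ‖g x - g y‖ ≤ L * |x - y|) →
      (∀ x ∈ cfI A, cfSumCoord q (g x) = 0) →
      (∀ x ∈ cfI A, ‖(cfCongL A q ((a : ℂ) + b * I))^[m] g x‖ ≤ (C * (q : ℝ) ^ C * ρ₀ ^ m) * (M + 1 * L)) ∧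
      (∀ a₁ ∈ A, ∀ a' ∈ A, ∀ x ∈ cfCyl A a₁ a', ∀ y ∈ cfCyl A a₁ a',
        ‖(cfCongL A q ((a : ℂ) + b * I))^[m] g x - (cfCongL A q ((a : ℂ) + b * I))^[m] g y‖ ≤
          (1 : ℝ)⁻¹ * ((C * (q : ℝ) ^ C * ρ₀ ^ m) * (M + 1 * L)) * |x - y|) := by
  intro m g M L hM hL hgM hgL hgℓ
  have hB : 0 ≤ C * (q : ℝ) ^ C * ρ₀ ^ m := by positivity
  obtain ⟨h1, h2'⟩ := cfCongL_iterate_pLip_of_c1 hA ((cfSumCoord q).restrictScalars ℝ) ((a : ℂ) + b * I) m hB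
    (fun F hF hFℓ => hT F hF (fun x hx => by have := hFℓ x hx; simpa using this) m) hM hL hgM hgL
    (fun x hx => by simpa using hgℓ x hx)
  simp only [one_mul, inv_one]
  exact ⟨h1, h2'⟩

end Glue

/-! ### The three regions -/

section Regions

variable {q}

include hA h2 in
/-- **Large `|Im s|` (Theorem 4 (2)):** for `s = a + ib` with `a ≥ 0` and Theorem 4 (2)-type bounds at
level `q`, `1 - 𝓜_s` is a unit of `End(Γ_q → CfLip)`, and for every `m₀` the inverse applied to the test
family `F_s` obeys the split sup bound
`|((1-𝓜_s)⁻¹F_s)_η(y)| ≤ 1 + #A²√|Γ_q| + #A⁴(4^a √|Γ_q| Σ_{m<m₀} λ_a^{2m} + 2 B_{m₀} (ΣB)(√|Γ_q| + √|Γ_q| 2‖s‖e^{2a}))`,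
`B_m = C_η |b|² ρ_η^m`. [cite: MageeOhWinter2019, Thm. 4 (2) and §3.4] -/
theorem region_large {a b Cη ρη : ℝ} (ha : 0 ≤ a) (hCη : 0 ≤ Cη) (hρη : 0 ≤ ρη) (hρη1 : ρη < 1)
    (hT : ∀ F : ℝ → CfVec q, ContDiffOn ℝ 1 F (cfI A) → ∀ m : ℕ,
      c1NormOn (cfI A) ((cfCongL A q ((a : ℂ) + b * I))^[m] F) ≤ Cη * |b| ^ (1 + (1 : ℝ)) * ρη ^ m * c1NormOn (cfI A) F) :
    IsUnit (1 - cfTwist A hA q ((a : ℂ) + b * I)) ∧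
    ∀ (m₀ : ℕ) (η : SL(2, ZMod q)) (y : Icc (0 : ℝ) 1),
      ‖(Ring.inverse (1 - cfTwist A hA q ((a : ℂ) + b * I)) (cfFamS q cfΘ₀ (CfLip.const 1) 1 ((a : ℂ) + b * I))) η y‖ ≤
        1 + (A.card : ℝ) ^ 2 * (Real.sqrt (Fintype.card (SL(2, ZMod q))) * 1) +
        (A.card : ℝ) ^ 4 * ((4 : ℝ) ^ a * (Real.sqrt (Fintype.card (SL(2, ZMod q))) * 1) *
            ∑ m ∈ Finset.range m₀, cfEig A a ^ (2 * m) +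
          2 * (Cη * |b| ^ (2 : ℝ) * ρη ^ m₀) * (∑' m, Cη * |b| ^ (2 : ℝ) * ρη ^ m) *
            (Real.sqrt (Fintype.card (SL(2, ZMod q))) * 1 +
              Real.sqrt (Fintype.card (SL(2, ZMod q))) * (2 * ‖(a : ℂ) + b * I‖ * Real.exp (2 * a)))) := by
  set s : ℂ := (a : ℂ) + b * I with hs
  have hsre : s.re = a := by simp [hs]
  have hs0 : 0 ≤ s.re := by rw [hsre]; exact ha
  set B : ℕ → ℝ := fun m => Cη * |b| ^ (2 : ℝ) * ρη ^ m with hBdef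
  have hB0 : ∀ m, 0 ≤ B m := fun m => by positivity
  have hBs : Summable B := (summable_geometric_of_lt_one hρη hρη1).mul_left _
  have hβ := thm4_large_bounds hA hCη hρη hT
  obtain ⟨hunit, hinv⟩ := isUnit_one_sub_cfTwist_of_bounds hA (q := q) hs0 one_pos hB0 hBs hβ
  have hβ' : ∀ (m : ℕ) (g : ℝ → CfVec q) (M L : ℝ), 0 ≤ M → 0 ≤ L → (∀ x ∈ cfI A, ‖g x‖ ≤ M) →
      (∀ a₁ ∈ A, ∀ a' ∈ A, ∀ x ∈ cfCyl A a₁ a', ∀ y ∈ cfCyl A a₁ a', ‖g x - g y‖ ≤ L * |x - y|) →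
      (∀ x ∈ cfI A, (0 : CfVec q →L[ℂ] ℂ) (g x) = 0) →
      (∀ x ∈ cfI A, ‖(cfCongL A q s)^[m] g x‖ ≤ B m * (M + 1 * L)) ∧
      (∀ a₁ ∈ A, ∀ a' ∈ A, ∀ x ∈ cfCyl A a₁ a', ∀ y ∈ cfCyl A a₁ a',
        ‖(cfCongL A q s)^[m] g x - (cfCongL A q s)^[m] g y‖ ≤ (1 : ℝ)⁻¹ * (B m * (M + 1 * L)) * |x - y|) :=
    fun m g M L hM hL h1 h2' _ => hβ m g M L hM hL h1 h2'
  refine ⟨hunit, fun m₀ η y => ?_⟩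
  obtain ⟨f1, f2⟩ := cfFamS_one_bounds (q := q) hs0
  set F := cfFamS q cfΘ₀ (CfLip.const 1) 1 s with hF
  set CΓ : ℝ := Real.sqrt (Fintype.card (SL(2, ZMod q))) with hCΓ
  have hCΓ0 : 0 ≤ CΓ := Real.sqrt_nonneg _
  have hLG : 0 ≤ 2 * ‖s‖ * Real.exp (2 * s.re) := by positivity
  -- control of `vec F` on `I`
  set g : ℝ → CfVec q := cfVecOf F with hg
  have hgM : ∀ x ∈ cfI A, ‖g x‖ ≤ CΓ * 1 := fun x _ => norm_cfVecOf_le F zero_le_one f1 x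
  have hgL : ∀ a₁ ∈ A, ∀ a' ∈ A, ∀ x ∈ cfCyl A a₁ a', ∀ y ∈ cfCyl A a₁ a',
      ‖g x - g y‖ ≤ CΓ * (2 * ‖s‖ * Real.exp (2 * s.re)) * |x - y| := fun a₁ ha₁ a' ha' x hx y hy => by
    have := norm_cfVecOf_sub_le F hLG f2 (cfI_subset_Icc hA (cfCyl_subset_cfI ha₁ ha' hx))
      (cfI_subset_Icc hA (cfCyl_subset_cfI ha₁ ha' hy))
    rw [← hCΓ] at this; linarith [this]
  have hℓ0 : ∀ (g' : SL(2, ZMod q)) (v : CfVec q), (0 : CfVec q →L[ℂ] ℂ) v = 0 → (0 : CfVec q →L[ℂ] ℂ) (cfRep g' v) = 0 :=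
    fun _ _ _ => rfl
  have hsplit : ∀ x ∈ cfI A, ‖cfSeries A q s g x‖ ≤ (4 : ℝ) ^ s.re * (CΓ * 1) * ∑ m ∈ Finset.range m₀, cfEig A s.re ^ (2 * m) +
      2 * B m₀ * (∑' m, B m) * (CΓ * 1 + CΓ * (2 * ‖s‖ * Real.exp (2 * s.re))) := fun x hx =>
    norm_cfSeries_le_split hA h2 hs0 hB0 hBs (0 : CfVec q →L[ℂ] ℂ) hβ' hℓ0 (M := CΓ * 1)
      (L := CΓ * (2 * ‖s‖ * Real.exp (2 * s.re))) (by positivity) (by positivity) hgM hgL (fun x _ => rfl) m₀ hx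
  rw [hinv F]
  have hM₁ : 0 ≤ (4 : ℝ) ^ s.re * (CΓ * 1) * ∑ m ∈ Finset.range m₀, cfEig A s.re ^ (2 * m) +
      2 * B m₀ * (∑' m, B m) * (CΓ * 1 + CΓ * (2 * ‖s‖ * Real.exp (2 * s.re))) := by
    have : 0 ≤ ∑ m ∈ Finset.range m₀, cfEig A s.re ^ (2 * m) := Finset.sum_nonneg fun m _ => pow_nonneg (cfEig_pos _).le _
    have hSB : 0 ≤ ∑' m, B m := tsum_nonneg hB0
    have hB₀ := hB0 m₀
    positivity
  have h := norm_cfPreimage_apply_le hA hs0 one_pos hB0 hBs (0 : CfVec q →L[ℂ] ℂ) hβ' F zero_le_one hLG f1 f2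
    (fun x _ => rfl) hM₁ hsplit η y
  rw [hsre] at h
  exact h

include hA in
/-- **Bounded `|Im s|`, values orthogonal to constants (Theorem 4 (1)):** with Theorem 4 (1)-type bounds
at level `q`, `1 - B_s` is a unit, and the inverse applied to `P₁ F_s` is bounded by
`2 + 2 #A² √|Γ_q| + #A⁴ (Σ_m C q^C ρ₀^m)(2√|Γ_q| + 2√|Γ_q| · 2‖s‖e^{2a})`.
[cite: MageeOhWinter2019, Thm. 4 (1) and §3.4] -/
theorem region_perp {a b C ρ₀ : ℝ} (ha : 0 ≤ a) (hC : 0 ≤ C) (hρ₀ : 0 ≤ ρ₀) (hρ₀1 : ρ₀ < 1)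
    (hT : ∀ F : ℝ → CfVec q, ContDiffOn ℝ 1 F (cfI A) → (∀ x ∈ cfI A, ∑ ξ, F x ξ = 0) → ∀ m : ℕ,
      c1NormOn (cfI A) ((cfCongL A q ((a : ℂ) + b * I))^[m] F) ≤ C * (q : ℝ) ^ C * ρ₀ ^ m * c1NormOn (cfI A) F) :
    IsUnit (1 - cfTwB A hA q ((a : ℂ) + b * I)) ∧
    ∀ (η : SL(2, ZMod q)) (y : Icc (0 : ℝ) 1),
      ‖(Ring.inverse (1 - cfTwB A hA q ((a : ℂ) + b * I))
          (cfTwP1 q (cfFamS q cfΘ₀ (CfLip.const 1) 1 ((a : ℂ) + b * I)))) η y‖ ≤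
        2 + (A.card : ℝ) ^ 2 * (Real.sqrt (Fintype.card (SL(2, ZMod q))) * 2) +
        (A.card : ℝ) ^ 4 * ((∑' m, C * (q : ℝ) ^ C * ρ₀ ^ m) *
          (Real.sqrt (Fintype.card (SL(2, ZMod q))) * 2 +
            1 * (Real.sqrt (Fintype.card (SL(2, ZMod q))) * (2 * (2 * ‖(a : ℂ) + b * I‖ * Real.exp (2 * a)))))) := by
  set s : ℂ := (a : ℂ) + b * I with hs
  have hsre : s.re = a := by simp [hs]
  have hs0 : 0 ≤ s.re := by rw [hsre]; exact ha
  set B : ℕ → ℝ := fun m => C * (q : ℝ) ^ C * ρ₀ ^ m with hBdef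
  have hB0 : ∀ m, 0 ≤ B m := fun m => by positivity
  have hBs : Summable B := (summable_geometric_of_lt_one hρ₀ hρ₀1).mul_left _
  have hβ := thm4_small_bounds hA hC hρ₀ hT
  obtain ⟨hunit, hinv⟩ := isUnit_one_sub_cfTwB_of_bounds hA (q := q) hs0 one_pos hB0 hBs hβ
  refine ⟨hunit, fun η y => ?_⟩
  set F := cfFamS q cfΘ₀ (CfLip.const 1) 1 s with hF
  have hP1sum : ∑ ξ, cfTwP1 q F ξ = 0 := sum_cfTwP1_apply F
  obtain ⟨p1, p2⟩ := cfTwP1_cfFamS_bounds (q := q) hs0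
  rw [hinv _ hP1sum]
  have hℓ : ∀ (g' : SL(2, ZMod q)) (v : CfVec q), cfSumCoord q v = 0 → cfSumCoord q (cfRep g' v) = 0 :=
    fun g' v hv => by rw [cfSumCoord_cfRep, hv]
  have hLG : 0 ≤ 2 * (2 * ‖s‖ * Real.exp (2 * s.re)) := by positivity
  obtain ⟨-, -, h3⟩ := cfPreimage_spec hA hs0 one_pos hB0 hBs (cfSumCoord q) hℓ hβ (cfTwP1 q F) zero_le_two hLG p1 p2
    (fun x _ => cfSumCoord_cfVecOf_eq_zero hP1sum x)
  have h := h3 η y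
  rw [hsre] at h
  exact h

end Regions

/-! ### The choice of `m₀` -/

section M0

/-- **The `m₀`-splitting arithmetic.** For `0 < ρ < 1`, `T ≥ 1`, `p ≥ 0` with `8p ≤ log(1/ρ)` and
`0 ≤ Λ ≤ e^{2p}`: with `m₀ = ⌈4 log T / log(1/ρ)⌉` one has `ρ^{m₀} T⁴ ≤ 1` (the Theorem-4 tail is harmless)
and `Σ_{m<m₀} Λ^m ≤ (1 + 8/log(1/ρ)) e^{2p} T^{3/2}` (the a priori head grows at most like `T^{3/2}`).
[cite: MageeOhWinter2019, §3.4] -/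
theorem m0_choice {ρ p Λ T : ℝ} (hρ0 : 0 < ρ) (hρ1 : ρ < 1) (hp : 0 ≤ p) (hp8 : 8 * p ≤ -Real.log ρ)
    (hΛ0 : 0 ≤ Λ) (hΛ : Λ ≤ Real.exp (2 * p)) (hT : 1 ≤ T) :
    ∃ m₀ : ℕ, ρ ^ m₀ * T ^ 4 ≤ 1 ∧
      ∑ m ∈ Finset.range m₀, Λ ^ m ≤ (1 + 8 / (-Real.log ρ)) * Real.exp (2 * p) * T ^ (3 / 2 : ℝ) := by
  set ℓ : ℝ := -Real.log ρ with hℓ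
  have hℓ0 : 0 < ℓ := by rw [hℓ]; exact neg_pos.2 (Real.log_neg hρ0 hρ1)
  have hT0 : 0 < T := by linarith
  have hlogT : 0 ≤ Real.log T := Real.log_nonneg hT
  set x : ℝ := 4 * Real.log T / ℓ with hx
  have hx0 : 0 ≤ x := by positivity
  set m₀ : ℕ := ⌈x⌉₊ with hm₀
  have hxm : x ≤ m₀ := Nat.le_ceil x
  have hmx : (m₀ : ℝ) < x + 1 := Nat.ceil_lt_add_one hx0
  refine ⟨m₀, ?_, ?_⟩
  · -- `ρ^{m₀} = e^{m₀ log ρ} ≤ e^{-4 log T} = T^{-4}`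
    have hρm : ρ ^ m₀ = Real.exp (m₀ * Real.log ρ) := by rw [Real.exp_nat_mul, Real.exp_log hρ0]
    have hT4 : T ^ 4 = Real.exp ((4 : ℕ) * Real.log T) := by rw [Real.exp_nat_mul, Real.exp_log hT0]
    rw [hρm, hT4, ← Real.exp_add]
    refine Real.exp_le_one_iff.2 ?_
    have h1 : x * ℓ = 4 * Real.log T := by rw [hx]; field_simp
    have h2' : (m₀ : ℝ) * ℓ ≥ 4 * Real.log T := by rw [← h1]; exact mul_le_mul_of_nonneg_right hxm hℓ0.le
    have : (m₀ : ℝ) * Real.log ρ = -((m₀ : ℝ) * ℓ) := by rw [hℓ]; ring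
    rw [this]; push_cast; linarith
  · -- head: each term `≤ (e^{2p})^{m₀}`, and `m₀ e^{2p m₀} ≤ (1 + 8/ℓ)√T · e^{2p} T`
    have hE1 : 1 ≤ Real.exp (2 * p) := Real.one_le_exp (by positivity)
    have hterm : ∀ m ∈ Finset.range m₀, Λ ^ m ≤ Real.exp (2 * p) ^ m₀ := fun m hm =>
      (pow_le_pow_left₀ hΛ0 hΛ m).trans (pow_le_pow_right₀ hE1 (Finset.mem_range.1 hm).le)
    refine (Finset.sum_le_sum hterm).trans ?_
    rw [Finset.sum_const, Finset.card_range, nsmul_eq_mul, ← Real.exp_nat_mul]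
    -- `2p m₀ ≤ 2p + log T`
    have hexp : Real.exp (m₀ * (2 * p)) ≤ Real.exp (2 * p) * T := by
      rw [← Real.exp_log hT0, ← Real.exp_add]
      refine Real.exp_le_exp.2 ?_
      have h8 : 8 * p * Real.log T ≤ ℓ * Real.log T := mul_le_mul_of_nonneg_right hp8 hlogT
      have hm1 : (m₀ : ℝ) * (2 * p) ≤ (x + 1) * (2 * p) := mul_le_mul_of_nonneg_right hmx.le (by positivity)
      have hx2 : x * (2 * p) = 8 * p * Real.log T / ℓ := by rw [hx]; ring
      have hx3 : 8 * p * Real.log T / ℓ ≤ Real.log T := by rw [div_le_iff₀ hℓ0]; linarith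
      nlinarith
    -- `m₀ ≤ (1 + 8/ℓ) √T`
    have hsqrt1 : 1 ≤ Real.sqrt T := Real.one_le_sqrt.2 hT
    have hlog2 : Real.log T ≤ 2 * Real.sqrt T := by
      have := Real.log_le_rpow_div hT0.le (by norm_num : (0 : ℝ) < 1 / 2)
      rw [← Real.sqrt_eq_rpow] at this; linarith
    have hm₀le : (m₀ : ℝ) ≤ (1 + 8 / ℓ) * Real.sqrt T := by
      have h1 : (m₀ : ℝ) ≤ 1 + 4 * Real.log T / ℓ := by rw [hx] at hmx; linarith
      have h2' : 4 * Real.log T / ℓ ≤ 8 / ℓ * Real.sqrt T := by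
        rw [div_mul_eq_mul_div, div_le_div_iff_of_pos_right hℓ0]; linarith
      nlinarith
    have hT32 : Real.sqrt T * T = T ^ (3 / 2 : ℝ) := by
      rw [Real.sqrt_eq_rpow, ← Real.rpow_add_one hT0.ne']; norm_num
    calc (m₀ : ℝ) * Real.exp (m₀ * (2 * p)) ≤ ((1 + 8 / ℓ) * Real.sqrt T) * (Real.exp (2 * p) * T) :=
          mul_le_mul hm₀le hexp (Real.exp_pos _).le (by positivity)
      _ = (1 + 8 / ℓ) * Real.exp (2 * p) * (Real.sqrt T * T) := by ring
      _ = (1 + 8 / ℓ) * Real.exp (2 * p) * T ^ (3 / 2 : ℝ) := by rw [hT32]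

/-- `|SL₂(ℤ/qℤ)| ≤ q⁴` (it injects into the `2 × 2` matrices). [folklore] -/
theorem card_sl_le (q : ℕ) [NeZero q] : (Fintype.card (SL(2, ZMod q)) : ℝ) ≤ (q : ℝ) ^ 4 := by
  have h : Fintype.card (SL(2, ZMod q)) ≤ Fintype.card (Matrix (Fin 2) (Fin 2) (ZMod q)) :=
    Fintype.card_le_of_injective (fun g => (g : Matrix (Fin 2) (Fin 2) (ZMod q))) Subtype.coe_injective
  have hM : Fintype.card (Matrix (Fin 2) (Fin 2) (ZMod q)) = q ^ 4 := by
    have : Fintype.card (Matrix (Fin 2) (Fin 2) (ZMod q)) = Fintype.card (Fin 2 → Fin 2 → ZMod q) := rfl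
    rw [this, Fintype.card_fun, Fintype.card_fun, ZMod.card, Fintype.card_fin]; ring
  rw [hM] at h
  exact_mod_cast h

/-- `√|SL₂(ℤ/qℤ)| ≤ q²`. [folklore] -/
theorem sqrt_card_sl_le (q : ℕ) [NeZero q] : Real.sqrt (Fintype.card (SL(2, ZMod q))) ≤ (q : ℝ) ^ 2 := by
  rw [Real.sqrt_le_left (by positivity)]
  have := card_sl_le q
  nlinarith

end M0

/-! ### The decomposition of the regular part for bounded `|Im s|` -/

section Decomp

variable {q}

/-- **Components of the regular part `H_op(s) F`** when `1 - L_s²` and `1 - B_s` are units: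
`(H_op(s)F)_η = ((1 - L_s²)⁻¹ - (s-δ)⁻¹(2κ)⁻¹Π)(Av F) + ((1 - B_s)⁻¹ P₁ F)_η`
(from `(1 - 𝓜_s)⁻¹ = lift((1 - L_s²)⁻¹) + (1 - B_s)⁻¹ P₁`, `cfTwist_inverse_eq`). [cite: MageeOhWinter2019, §3.4] -/
theorem cfTwHop_apply_eq {s : ℂ} (hL : IsUnit (1 - cfLOp A hA s ^ 2)) (hB : IsUnit (1 - cfTwB A hA q s))
    (F : SL(2, ZMod q) → CfLip) (η : SL(2, ZMod q)) :
    cfTwHop A hA h2 q s F η =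
      (Ring.inverse (1 - cfLOp A hA s ^ 2) -
          ((s - cfDimension A)⁻¹ * (((2 * cfInt (cfNuδ A hA h2) (cfG A hA h2) : ℝ) : ℂ))⁻¹) • cfPi A hA h2) (cfTwAv q F) +
        (Ring.inverse (1 - cfTwB A hA q s) (cfTwP1 q F)) η := by
  obtain ⟨-, hinv⟩ := cfTwist_inverse_eq A hA q hL hB
  set X := Ring.inverse (1 - cfLOp A hA s ^ 2) with hX
  set Rb := Ring.inverse (1 - cfTwB A hA q s) with hRb
  set c : ℂ := (s - cfDimension A)⁻¹ with hc
  set k : ℂ := (((2 * cfInt (cfNuδ A hA h2) (cfG A hA h2) : ℝ) : ℂ))⁻¹ with hk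
  have e1 : cfTwHop A hA h2 q s F η = X (cfTwAv q F) + Rb (cfTwP1 q F) η - c • (k • cfPi A hA h2 (cfTwAv q F)) := by
    rw [cfTwHop, hinv]; rfl
  have e2 : (X - (c * k) • cfPi A hA h2) (cfTwAv q F) + Rb (cfTwP1 q F) η =
      X (cfTwAv q F) - (c * k) • cfPi A hA h2 (cfTwAv q F) + Rb (cfTwP1 q F) η := rfl
  rw [e1, e2, smul_smul]
  abel

end Decomp

/-! ### Auxiliary estimates for the regular part -/

section Aux

variable {q}

/-- Growth of `1 + 2‖s‖e^{2 Re s}` on `0 ≤ Re s ≤ δ + 1`: at most `E (1 + |Im s|)`,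
`E = 2e^{2(δ+1)}(δ+2) + 1`. [folklore] -/
theorem one_add_norm_mul_exp_le {δ : ℝ} (hδ : 0 < δ) (s : ℂ) (h0 : 0 ≤ s.re) (h1 : s.re ≤ δ + 1) :
    1 + 2 * ‖s‖ * Real.exp (2 * s.re) ≤ (2 * Real.exp (2 * (δ + 1)) * (δ + 2) + 1) * (1 + |s.im|) := by
  have hn : ‖s‖ ≤ |s.re| + |s.im| := Complex.norm_le_abs_re_add_abs_im s
  rw [abs_of_nonneg h0] at hn
  have he : Real.exp (2 * s.re) ≤ Real.exp (2 * (δ + 1)) := Real.exp_le_exp.2 (by linarith)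
  set e := Real.exp (2 * (δ + 1)) with hedef
  have he0 : 0 < e := Real.exp_pos _
  have ht : 0 ≤ |s.im| := abs_nonneg _
  have h3 : 2 * ‖s‖ * Real.exp (2 * s.re) ≤ 2 * (δ + 1 + |s.im|) * e :=
    mul_le_mul (by nlinarith [norm_nonneg s]) he (Real.exp_pos _).le (by positivity)
  have h4 : δ + 1 + |s.im| ≤ (δ + 2) * (1 + |s.im|) := by nlinarith
  have h5 : 2 * (δ + 1 + |s.im|) * e ≤ 2 * e * (δ + 2) * (1 + |s.im|) := by
    have := mul_le_mul_of_nonneg_left h4 (by positivity : (0 : ℝ) ≤ 2 * e)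
    nlinarith
  nlinarith

/-- `‖Av F_s‖ ≤ 1 + 2‖s‖e^{2 Re s}` for the test family. [cite: MageeOhWinter2019, §3.2] -/
theorem norm_cfTwAv_cfFamS_le {s : ℂ} (hs : 0 ≤ s.re) :
    ‖cfTwAv q (cfFamS q cfΘ₀ (CfLip.const 1) 1 s)‖ ≤ 1 + 2 * ‖s‖ * Real.exp (2 * s.re) := by
  rw [cfFamS, cfTwAv_cfTwSingle, norm_smul]
  obtain ⟨g1, g2⟩ := cfPowFam_one_bounds hs
  have hG : ‖cfΘ₀.cfPowFam (CfLip.const 1) 2 s‖ ≤ 1 + 2 * ‖s‖ * Real.exp (2 * s.re) :=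
    CfLip.norm_le_of_bounds (by positivity) g1 g2
  set N : ℂ := (Fintype.card (SL(2, ZMod q)) : ℂ) with hN'
  have hN : ‖N⁻¹‖ ≤ 1 := by
    rw [norm_inv, hN', Complex.norm_natCast]
    exact inv_le_one_of_one_le₀ (by exact_mod_cast Fintype.card_pos)
  calc ‖N⁻¹‖ * ‖cfΘ₀.cfPowFam (CfLip.const 1) 2 s‖ ≤ 1 * (1 + 2 * ‖s‖ * Real.exp (2 * s.re)) :=
      mul_le_mul hN hG (norm_nonneg _) zero_le_one
    _ = _ := one_mul _

/-- `‖Av F‖ ≤ ‖F‖`. [folklore] -/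
theorem norm_cfTwAv_le (F : SL(2, ZMod q) → CfLip) : ‖cfTwAv q F‖ ≤ ‖F‖ := by
  rw [cfTwAv_apply, norm_smul, norm_inv, Complex.norm_natCast]
  have hcard : (0 : ℝ) < Fintype.card (SL(2, ZMod q)) := by exact_mod_cast Fintype.card_pos
  have hsum : ‖∑ ξ, F ξ‖ ≤ (Fintype.card (SL(2, ZMod q)) : ℝ) * ‖F‖ := by
    calc ‖∑ ξ, F ξ‖ ≤ ∑ ξ, ‖F ξ‖ := norm_sum_le _ _
      _ ≤ ∑ _ξ : SL(2, ZMod q), ‖F‖ := Finset.sum_le_sum fun ξ _ => norm_le_pi_norm F ξ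
      _ = (Fintype.card (SL(2, ZMod q)) : ℝ) * ‖F‖ := by rw [Finset.sum_const, Finset.card_univ, nsmul_eq_mul]
  calc (Fintype.card (SL(2, ZMod q)) : ℝ)⁻¹ * ‖∑ ξ, F ξ‖ ≤ (Fintype.card (SL(2, ZMod q)) : ℝ)⁻¹ * ((Fintype.card (SL(2, ZMod q)) : ℝ) * ‖F‖) :=
        mul_le_mul_of_nonneg_left hsum (inv_nonneg.2 hcard.le)
    _ = ‖F‖ := by field_simp

/-- **`‖Res‖ ≤ |2κ_A|⁻¹ ‖Π‖`, uniformly in `q`.** [cite: MageeOhWinter2019, §3.4] -/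
theorem norm_cfTwResOp_le :
    ‖cfTwResOp A hA h2 q‖ ≤ ‖((((2 * cfInt (cfNuδ A hA h2) (cfG A hA h2) : ℝ)) : ℂ))⁻¹‖ * ‖cfPi A hA h2‖ := by
  refine ContinuousLinearMap.opNorm_le_bound _ (by positivity) fun F => ?_
  rw [cfTwResOp]
  rw [show ((((2 * cfInt (cfNuδ A hA h2) (cfG A hA h2) : ℝ) : ℂ))⁻¹ • cfTwLift q (cfPi A hA h2)) F =
    (((2 * cfInt (cfNuδ A hA h2) (cfG A hA h2) : ℝ) : ℂ))⁻¹ • (cfTwLift q (cfPi A hA h2) F) from rfl, norm_smul, mul_assoc]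
  refine mul_le_mul_of_nonneg_left ?_ (norm_nonneg _)
  have hpos : 0 ≤ ‖cfPi A hA h2‖ * ‖F‖ := by positivity
  rw [pi_norm_le_iff_of_nonneg hpos]
  intro ξ
  rw [cfTwLift_apply]
  exact (ContinuousLinearMap.le_opNorm _ _).trans (mul_le_mul_of_nonneg_left (norm_cfTwAv_le F) (norm_nonneg _))

/-- The pole term: `|((s-δ)⁻¹ Res F)_η(y)| ≤ |s-δ|⁻¹ ‖Res‖ ‖F‖`. [cite: MageeOhWinter2019, §3.4] -/
theorem norm_pole_term_le (s : ℂ) (F : SL(2, ZMod q) → CfLip) (η : SL(2, ZMod q)) (y : Icc (0 : ℝ) 1) :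
    ‖(((s - cfDimension A)⁻¹ • cfTwResOp A hA h2 q) F) η y‖ ≤ ‖s - cfDimension A‖⁻¹ * ‖cfTwResOp A hA h2 q‖ * ‖F‖ := by
  have e : (((s - cfDimension A)⁻¹ • cfTwResOp A hA h2 q) F) η y = (s - cfDimension A)⁻¹ * (cfTwResOp A hA h2 q F) η y := by
    rw [show (((s - cfDimension A)⁻¹ • cfTwResOp A hA h2 q) F) η = (s - cfDimension A)⁻¹ • (cfTwResOp A hA h2 q F) η from rfl,
      CfLip.smul_apply]
  rw [e, norm_mul, norm_inv, mul_assoc]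
  refine mul_le_mul_of_nonneg_left ?_ (inv_nonneg.2 (norm_nonneg _))
  exact ((CfLip.norm_apply_le _ y).trans (norm_le_pi_norm _ η)).trans (ContinuousLinearMap.le_opNorm _ _)

/-- Components of `H_op(s) F`: `(H_op F)_η(y) = ((1-𝓜)⁻¹F)_η(y) - ((s-δ)⁻¹ Res F)_η(y)`. [folklore] -/
theorem cfTwHop_apply' (s : ℂ) (F : SL(2, ZMod q) → CfLip) (η : SL(2, ZMod q)) (y : Icc (0 : ℝ) 1) :
    cfTwHop A hA h2 q s F η y = (Ring.inverse (1 - cfTwist A hA q s) F) η y -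
      (((s - cfDimension A)⁻¹ • cfTwResOp A hA h2 q) F) η y := by
  rw [show cfTwHop A hA h2 q s F η = (Ring.inverse (1 - cfTwist A hA q s) F) η -
    (((s - cfDimension A)⁻¹ • cfTwResOp A hA h2 q) F) η from rfl, CfLip.sub_apply]

include h2 in
/-- **Case `Re s ≥ δ + ε/2` of the resolvent bound** (Neumann + pole term). [cite: MageeOhWinter2019, §3.4] -/
theorem hop_bound_far {ε : ℝ} (hε : 0 < ε) {u t : ℝ} (hu : cfDimension A + ε / 2 ≤ u) (hu1 : u ≤ cfDimension A + 1)
    (η : SL(2, ZMod q)) (y : Icc (0 : ℝ) 1) :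
    ‖cfTwHop A hA h2 q ((u : ℂ) + t * I) (cfFamS q cfΘ₀ (CfLip.const 1) 1 ((u : ℂ) + t * I)) η y‖ ≤
      ((4 : ℝ) ^ (cfDimension A + 1) * (1 - cfEig A (cfDimension A + ε / 2) ^ 2)⁻¹ + (ε / 2)⁻¹ * ‖cfTwResOp A hA h2 q‖) *
        ((2 * Real.exp (2 * (cfDimension A + 1)) * (cfDimension A + 2) + 1) * (1 + |t|)) := by
  set δ := cfDimension A with hδ
  have hδ0 : 0 < δ := cfDimension_pos hA h2
  have hne := nonempty_of_two_le_card h2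
  set s : ℂ := (u : ℂ) + t * I with hs
  have hsre : s.re = u := by simp [hs]
  have hsim : s.im = t := by simp [hs]
  have hs0 : 0 ≤ s.re := by rw [hsre]; linarith
  have hδu : δ < s.re := by rw [hsre]; linarith
  set F := cfFamS q cfΘ₀ (CfLip.const 1) 1 s with hF
  set E := (2 * Real.exp (2 * (δ + 1)) * (δ + 2) + 1) with hE
  have hFn : ‖F‖ ≤ E * (1 + |t|) := by
    have := (norm_cfFamS_one_le (q := q) hs0).trans (one_add_norm_mul_exp_le hδ0 s hs0 (by rw [hsre]; exact hu1))
    rwa [hsim] at this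
  have hEt : 0 ≤ E * (1 + |t|) := by positivity
  -- Neumann part
  have hlamu : cfEig A s.re ≤ cfEig A (δ + ε / 2) :=
    Real.exp_le_exp.2 (cfPressure_antitoneOn hA hne (show δ + ε / 2 ∈ Ici (0:ℝ) from by show (0:ℝ) ≤ δ + ε / 2; positivity)
      (show s.re ∈ Ici (0:ℝ) from hs0) (by rw [hsre]; exact hu))
  have hlam1 : cfEig A (δ + ε / 2) < 1 := cfEig_lt_one_of_lt A hA h2 (by linarith)
  have hlam0 : 0 < cfEig A s.re := cfEig_pos _
  have h1 : ‖(Ring.inverse (1 - cfTwist A hA q s) F) η y‖ ≤ (4 : ℝ) ^ (δ + 1) * (1 - cfEig A (δ + ε / 2) ^ 2)⁻¹ * (E * (1 + |t|)) := by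
    refine (norm_inverse_one_sub_cfTwist_apply_le hA h2 q hδu F η y).trans ?_
    have h4 : (4 : ℝ) ^ s.re ≤ (4 : ℝ) ^ (δ + 1) := Real.rpow_le_rpow_of_exponent_le (by norm_num) (by rw [hsre]; exact hu1)
    have hgap : (1 - cfEig A s.re ^ 2)⁻¹ ≤ (1 - cfEig A (δ + ε / 2) ^ 2)⁻¹ := by
      have hl0 : 0 < cfEig A (δ + ε / 2) := cfEig_pos _
      apply inv_anti₀ (by nlinarith)
      nlinarith [mul_le_mul hlamu hlamu hlam0.le hl0.le]
    have hlt1 : cfEig A s.re < 1 := cfEig_lt_one_of_lt A hA h2 hδu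
    have hi0 : 0 ≤ (1 - cfEig A s.re ^ 2)⁻¹ := inv_nonneg.2 (by nlinarith)
    have h40 : 0 ≤ (4 : ℝ) ^ (δ + 1) := by positivity
    have hK0 : 0 ≤ (4 : ℝ) ^ (δ + 1) * (1 - cfEig A (δ + ε / 2) ^ 2)⁻¹ :=
      mul_nonneg h40 (inv_nonneg.2 (by nlinarith))
    exact mul_le_mul (mul_le_mul h4 hgap hi0 h40) hFn (norm_nonneg _) hK0
  -- pole part
  have hdist : ε / 2 ≤ ‖s - δ‖ := by
    have : (s - δ).re = u - δ := by simp [hs]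
    calc ε / 2 ≤ u - δ := by linarith
      _ = |(s - δ).re| := by rw [this, abs_of_nonneg (by linarith)]
      _ ≤ ‖s - δ‖ := Complex.abs_re_le_norm _
  have h2' : ‖(((s - δ)⁻¹ • cfTwResOp A hA h2 q) F) η y‖ ≤ (ε / 2)⁻¹ * ‖cfTwResOp A hA h2 q‖ * (E * (1 + |t|)) := by
    refine (norm_pole_term_le hA h2 s F η y).trans ?_
    exact mul_le_mul (mul_le_mul_of_nonneg_right (inv_anti₀ (by positivity) hdist) (norm_nonneg _)) hFn (norm_nonneg _)
      (by positivity)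
  rw [cfTwHop_apply']
  calc _ ≤ ‖(Ring.inverse (1 - cfTwist A hA q s) F) η y‖ + ‖(((s - δ)⁻¹ • cfTwResOp A hA h2 q) F) η y‖ := norm_sub_le _ _
    _ ≤ _ := by rw [add_mul]; exact add_le_add h1 h2'

set_option maxHeartbeats 400000 in
include hA h2 in
/-- **Case `|Im s| > b₀`, `Re s < δ + ε/2` of the resolvent bound** (Theorem 4 (2), `m₀`-splitting, pole term).
[cite: MageeOhWinter2019, Thm. 4 (2) and §3.4] -/
theorem hop_bound_bigT {b₀ Cη ρ p σ₁ : ℝ} (hb₀ : 0 < b₀) (hCη : 0 ≤ Cη) (hρ0 : 0 < ρ) (hρ1 : ρ < 1) (hp : 0 ≤ p)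
    (hp8 : 8 * p ≤ -Real.log ρ) (hσ₁0 : 0 ≤ σ₁) (hpσ : cfPressure A σ₁ = p)
    {u t : ℝ} (hσu : σ₁ ≤ u) (hu1 : u ≤ cfDimension A + 1) (ht : b₀ < |t|)
    (hT : ∀ F : ℝ → CfVec q, ContDiffOn ℝ 1 F (cfI A) → ∀ m : ℕ,
      c1NormOn (cfI A) ((cfCongL A q ((u : ℂ) + t * I))^[m] F) ≤ Cη * |t| ^ (1 + (1 : ℝ)) * ρ ^ m * c1NormOn (cfI A) F)
    (η : SL(2, ZMod q)) (y : Icc (0 : ℝ) 1) :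
    ‖cfTwHop A hA h2 q ((u : ℂ) + t * I) (cfFamS q cfΘ₀ (CfLip.const 1) 1 ((u : ℂ) + t * I)) η y‖ ≤
      ((1 + (A.card : ℝ) ^ 2 + (A.card : ℝ) ^ 4 * ((4 : ℝ) ^ (cfDimension A + 1) * ((1 + 8 / (-Real.log ρ)) * Real.exp (2 * p)) +
          2 * Cη ^ 2 * (1 - ρ)⁻¹ * (2 * Real.exp (2 * (cfDimension A + 1)) * (cfDimension A + 2) + 1))) +
        b₀⁻¹ * ‖cfTwResOp A hA h2 q‖ * (2 * Real.exp (2 * (cfDimension A + 1)) * (cfDimension A + 2) + 1)) *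
      (q : ℝ) ^ 2 * (1 + |t|) ^ (3 / 2 : ℝ) := by
  set δ := cfDimension A with hδ
  have hδ0 : 0 < δ := cfDimension_pos hA h2
  have hne := nonempty_of_two_le_card h2
  set s : ℂ := (u : ℂ) + t * I with hs
  have hsre : s.re = u := by simp [hs]
  have hsim : s.im = t := by simp [hs]
  have hu0 : 0 ≤ u := hσ₁0.trans hσu
  have hs0 : 0 ≤ s.re := by rw [hsre]; exact hu0
  set F := cfFamS q cfΘ₀ (CfLip.const 1) 1 s with hF
  set E := (2 * Real.exp (2 * (δ + 1)) * (δ + 2) + 1) with hE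
  have hE1 : 1 ≤ E := by
    have : 0 ≤ 2 * Real.exp (2 * (δ + 1)) * (δ + 2) := by positivity
    rw [hE]; linarith
  set T : ℝ := 1 + |t| with hTdef
  have hT1 : 1 ≤ T := by rw [hTdef]; linarith [abs_nonneg t]
  have hT0 : 0 < T := by linarith
  have hgrow : 1 + 2 * ‖s‖ * Real.exp (2 * s.re) ≤ E * T := by
    have := one_add_norm_mul_exp_le hδ0 s hs0 (by rw [hsre]; exact hu1); rwa [hsim] at this
  have hFn : ‖F‖ ≤ E * T := (norm_cfFamS_one_le (q := q) hs0).trans hgrow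
  -- `m₀`
  set Λ : ℝ := cfEig A u ^ 2 with hΛ
  have hΛ0 : 0 ≤ Λ := by positivity
  have hΛe : Λ ≤ Real.exp (2 * p) := by
    have hPu : cfPressure A u ≤ p := by
      rw [← hpσ]; exact cfPressure_antitoneOn hA hne (show σ₁ ∈ Ici (0:ℝ) from hσ₁0) (show u ∈ Ici (0:ℝ) from hu0) hσu
    rw [hΛ, cfEig, ← Real.exp_nat_mul]
    exact Real.exp_le_exp.2 (by push_cast; linarith)
  obtain ⟨m₀, htail, hhead⟩ := m0_choice hρ0 hρ1 hp hp8 hΛ0 hΛe hT1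
  -- the split bound from `region_large`
  obtain ⟨-, hbound⟩ := region_large hA h2 (q := q) hu0 hCη hρ0.le hρ1 hT
  have hres := hbound m₀ η y
  set CΓ : ℝ := Real.sqrt (Fintype.card (SL(2, ZMod q))) with hCΓ
  have hCΓq : CΓ ≤ (q : ℝ) ^ 2 := sqrt_card_sl_le q
  have hCΓ0 : 0 ≤ CΓ := Real.sqrt_nonneg _
  have hq1 : (1 : ℝ) ≤ (q : ℝ) ^ 2 := one_le_pow₀ (by exact_mod_cast Nat.one_le_iff_ne_zero.2 (NeZero.ne q))
  -- geometric sums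
  have htsum : ∑' m, Cη * |t| ^ (2 : ℝ) * ρ ^ m = Cη * |t| ^ (2 : ℝ) * (1 - ρ)⁻¹ := by
    rw [tsum_mul_left, tsum_geometric_of_lt_one hρ0.le hρ1]
  have ht2 : |t| ^ (2 : ℝ) = |t| ^ 2 := by norm_cast
  have htT : |t| ≤ T := by rw [hTdef]; linarith [abs_nonneg t]
  have ht4 : |t| ^ 4 * ρ ^ m₀ ≤ 1 := by
    calc |t| ^ 4 * ρ ^ m₀ ≤ T ^ 4 * ρ ^ m₀ := by gcongr
      _ = ρ ^ m₀ * T ^ 4 := by ring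
      _ ≤ 1 := htail
  -- tail term
  have htailterm : 2 * (Cη * |t| ^ (2 : ℝ) * ρ ^ m₀) * (∑' m, Cη * |t| ^ (2 : ℝ) * ρ ^ m) * (CΓ * 1 + CΓ * (2 * ‖s‖ * Real.exp (2 * u))) ≤
      2 * Cη ^ 2 * (1 - ρ)⁻¹ * E * ((q : ℝ) ^ 2 * T) := by
    rw [htsum, ht2]
    have hinner : CΓ * 1 + CΓ * (2 * ‖s‖ * Real.exp (2 * u)) ≤ (q : ℝ) ^ 2 * (E * T) := by
      rw [← hsre]
      calc CΓ * 1 + CΓ * (2 * ‖s‖ * Real.exp (2 * s.re)) = CΓ * (1 + 2 * ‖s‖ * Real.exp (2 * s.re)) := by ring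
        _ ≤ (q : ℝ) ^ 2 * (E * T) := mul_le_mul hCΓq hgrow (by positivity) (by positivity)
    have hρinv : 0 ≤ (1 - ρ)⁻¹ := inv_nonneg.2 (by linarith)
    calc 2 * (Cη * |t| ^ 2 * ρ ^ m₀) * (Cη * |t| ^ 2 * (1 - ρ)⁻¹) * (CΓ * 1 + CΓ * (2 * ‖s‖ * Real.exp (2 * u)))
        = (2 * Cη ^ 2 * (1 - ρ)⁻¹) * (|t| ^ 4 * ρ ^ m₀) * (CΓ * 1 + CΓ * (2 * ‖s‖ * Real.exp (2 * u))) := by ring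
      _ ≤ (2 * Cη ^ 2 * (1 - ρ)⁻¹) * 1 * ((q : ℝ) ^ 2 * (E * T)) := by
          apply mul_le_mul (mul_le_mul_of_nonneg_left ht4 (by positivity)) hinner (by positivity) (by positivity)
      _ = 2 * Cη ^ 2 * (1 - ρ)⁻¹ * E * ((q : ℝ) ^ 2 * T) := by ring
  -- head term
  have hheadterm : (4 : ℝ) ^ u * (CΓ * 1) * ∑ m ∈ Finset.range m₀, cfEig A u ^ (2 * m) ≤
      (4 : ℝ) ^ (δ + 1) * ((1 + 8 / (-Real.log ρ)) * Real.exp (2 * p)) * ((q : ℝ) ^ 2 * T ^ (3 / 2 : ℝ)) := by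
    have h4 : (4 : ℝ) ^ u ≤ (4 : ℝ) ^ (δ + 1) := Real.rpow_le_rpow_of_exponent_le (by norm_num) hu1
    have hsum : ∑ m ∈ Finset.range m₀, cfEig A u ^ (2 * m) ≤ (1 + 8 / (-Real.log ρ)) * Real.exp (2 * p) * T ^ (3 / 2 : ℝ) := by
      have : ∑ m ∈ Finset.range m₀, cfEig A u ^ (2 * m) = ∑ m ∈ Finset.range m₀, Λ ^ m :=
        Finset.sum_congr rfl fun m _ => by rw [hΛ, pow_mul]
      rw [this]; exact hhead
    have hs0' : 0 ≤ ∑ m ∈ Finset.range m₀, cfEig A u ^ (2 * m) := Finset.sum_nonneg fun m _ => pow_nonneg (cfEig_pos _).le _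
    have hℓ : 0 ≤ 1 + 8 / (-Real.log ρ) := by
      have : 0 < -Real.log ρ := neg_pos.2 (Real.log_neg hρ0 hρ1); positivity
    calc (4 : ℝ) ^ u * (CΓ * 1) * ∑ m ∈ Finset.range m₀, cfEig A u ^ (2 * m)
        ≤ (4 : ℝ) ^ (δ + 1) * ((q : ℝ) ^ 2 * 1) * ((1 + 8 / (-Real.log ρ)) * Real.exp (2 * p) * T ^ (3 / 2 : ℝ)) := by
          apply mul_le_mul (mul_le_mul h4 (by nlinarith) (by positivity) (by positivity)) hsum hs0' (by positivity)
      _ = _ := by ring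
  -- the resolvent part
  have hT32 : T ≤ T ^ (3 / 2 : ℝ) := by
    have := Real.rpow_le_rpow_of_exponent_le hT1 (show (1 : ℝ) ≤ 3 / 2 by norm_num); rwa [Real.rpow_one] at this
  have hqT : 1 ≤ (q : ℝ) ^ 2 * T ^ (3 / 2 : ℝ) := one_le_mul_of_one_le_of_one_le hq1 (hT1.trans hT32)
  have hres' : ‖(Ring.inverse (1 - cfTwist A hA q s) F) η y‖ ≤
      (1 + (A.card : ℝ) ^ 2 + (A.card : ℝ) ^ 4 * ((4 : ℝ) ^ (δ + 1) * ((1 + 8 / (-Real.log ρ)) * Real.exp (2 * p)) +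
          2 * Cη ^ 2 * (1 - ρ)⁻¹ * E)) * ((q : ℝ) ^ 2 * T ^ (3 / 2 : ℝ)) := by
    refine hres.trans ?_
    have hc2 : 0 ≤ (A.card : ℝ) ^ 2 := by positivity
    have hc4 : 0 ≤ (A.card : ℝ) ^ 4 := by positivity
    have e1 : (1 : ℝ) ≤ 1 * ((q : ℝ) ^ 2 * T ^ (3 / 2 : ℝ)) := by linarith
    have e2 : (A.card : ℝ) ^ 2 * (CΓ * 1) ≤ (A.card : ℝ) ^ 2 * ((q : ℝ) ^ 2 * T ^ (3 / 2 : ℝ)) := by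
      apply mul_le_mul_of_nonneg_left _ hc2
      calc CΓ * 1 = CΓ := mul_one _
        _ ≤ (q : ℝ) ^ 2 * 1 := by linarith
        _ ≤ (q : ℝ) ^ 2 * T ^ (3 / 2 : ℝ) := mul_le_mul_of_nonneg_left (hT1.trans hT32) (by positivity)
    have e3 : 2 * Cη ^ 2 * (1 - ρ)⁻¹ * E * ((q : ℝ) ^ 2 * T) ≤ 2 * Cη ^ 2 * (1 - ρ)⁻¹ * E * ((q : ℝ) ^ 2 * T ^ (3 / 2 : ℝ)) := by
      have hρinv : 0 ≤ (1 - ρ)⁻¹ := inv_nonneg.2 (by linarith)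
      apply mul_le_mul_of_nonneg_left (mul_le_mul_of_nonneg_left hT32 (by positivity)) (by positivity)
    have e4 := mul_le_mul_of_nonneg_left (add_le_add hheadterm (htailterm.trans e3)) hc4
    refine (add_le_add (add_le_add e1 e2) e4).trans (le_of_eq ?_)
    ring
  -- the pole part
  have hdist : b₀ ≤ ‖s - δ‖ := by
    have : (s - δ).im = t := by simp [hs]
    calc b₀ ≤ |t| := ht.le
      _ = |(s - δ).im| := by rw [this]
      _ ≤ ‖s - δ‖ := Complex.abs_im_le_norm _
  have hpole : ‖(((s - δ)⁻¹ • cfTwResOp A hA h2 q) F) η y‖ ≤ b₀⁻¹ * ‖cfTwResOp A hA h2 q‖ * E * ((q : ℝ) ^ 2 * T ^ (3 / 2 : ℝ)) := by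
    refine (norm_pole_term_le hA h2 s F η y).trans ?_
    have h1 : ‖s - δ‖⁻¹ ≤ b₀⁻¹ := inv_anti₀ hb₀ hdist
    have hTX : T ≤ (q : ℝ) ^ 2 * T ^ (3 / 2 : ℝ) :=
      calc T ≤ 1 * T ^ (3 / 2 : ℝ) := by rw [one_mul]; exact hT32
        _ ≤ (q : ℝ) ^ 2 * T ^ (3 / 2 : ℝ) := mul_le_mul_of_nonneg_right hq1 (by positivity)
    have hF' : ‖F‖ ≤ E * ((q : ℝ) ^ 2 * T ^ (3 / 2 : ℝ)) := hFn.trans (mul_le_mul_of_nonneg_left hTX (by linarith))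
    calc ‖s - ↑δ‖⁻¹ * ‖cfTwResOp A hA h2 q‖ * ‖F‖ ≤ b₀⁻¹ * ‖cfTwResOp A hA h2 q‖ * (E * ((q : ℝ) ^ 2 * T ^ (3 / 2 : ℝ))) :=
          mul_le_mul (mul_le_mul_of_nonneg_right h1 (norm_nonneg _)) hF' (norm_nonneg _) (by positivity)
      _ = _ := by ring
  rw [cfTwHop_apply']
  calc _ ≤ ‖(Ring.inverse (1 - cfTwist A hA q s) F) η y‖ + ‖(((s - δ)⁻¹ • cfTwResOp A hA h2 q) F) η y‖ := norm_sub_le _ _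
    _ ≤ _ := by
        refine (add_le_add hres' hpole).trans (le_of_eq ?_)
        ring

set_option maxHeartbeats 400000 in
include hA in
/-- **Case `|Im s| ≤ b₀`, `|Re s - δ| < ε` of the resolvent bound** (decomposition: scalar regular part bounded
by `M_X`, part orthogonal to constants by Theorem 4 (1)). [cite: MageeOhWinter2019, Thm. 4 (1) and §3.4] -/
theorem hop_bound_smallT {C ρ₀ MX : ℝ} (hC : 0 ≤ C) (hρ₀0 : 0 ≤ ρ₀) (hρ₀1 : ρ₀ < 1) (hMX : 0 ≤ MX)
    {u t : ℝ} (hu0 : 0 ≤ u) (hu1 : u ≤ cfDimension A + 1)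
    (hLu : IsUnit (1 - cfLOp A hA ((u : ℂ) + t * I) ^ 2))
    (hX : ‖Ring.inverse (1 - cfLOp A hA ((u : ℂ) + t * I) ^ 2) -
        ((((u : ℂ) + t * I) - cfDimension A)⁻¹ * (((2 * cfInt (cfNuδ A hA h2) (cfG A hA h2) : ℝ) : ℂ))⁻¹) • cfPi A hA h2‖ ≤ MX)
    (hT : ∀ F : ℝ → CfVec q, ContDiffOn ℝ 1 F (cfI A) → (∀ x ∈ cfI A, ∑ ξ, F x ξ = 0) → ∀ m : ℕ,
      c1NormOn (cfI A) ((cfCongL A q ((u : ℂ) + t * I))^[m] F) ≤ C * (q : ℝ) ^ C * ρ₀ ^ m * c1NormOn (cfI A) F)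
    (η : SL(2, ZMod q)) (y : Icc (0 : ℝ) 1) :
    ‖cfTwHop A hA h2 q ((u : ℂ) + t * I) (cfFamS q cfΘ₀ (CfLip.const 1) 1 ((u : ℂ) + t * I)) η y‖ ≤
      (MX * (2 * Real.exp (2 * (cfDimension A + 1)) * (cfDimension A + 2) + 1) + 2 + 2 * (A.card : ℝ) ^ 2 +
        2 * (A.card : ℝ) ^ 4 * C * (1 - ρ₀)⁻¹ * (2 * Real.exp (2 * (cfDimension A + 1)) * (cfDimension A + 2) + 1)) *
      (q : ℝ) ^ (C + 2) * (1 + |t|) := by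
  set δ := cfDimension A with hδ
  have hδ0 : 0 < δ := cfDimension_pos hA h2
  set s : ℂ := (u : ℂ) + t * I with hs
  have hsre : s.re = u := by simp [hs]
  have hsim : s.im = t := by simp [hs]
  have hs0 : 0 ≤ s.re := by rw [hsre]; exact hu0
  set F := cfFamS q cfΘ₀ (CfLip.const 1) 1 s with hF
  set E := (2 * Real.exp (2 * (δ + 1)) * (δ + 2) + 1) with hE
  have hE1 : 1 ≤ E := by
    have : 0 ≤ 2 * Real.exp (2 * (δ + 1)) * (δ + 2) := by positivity
    rw [hE]; linarith
  set T : ℝ := 1 + |t| with hTdef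
  have hT1 : 1 ≤ T := by rw [hTdef]; linarith [abs_nonneg t]
  have hgrow : 1 + 2 * ‖s‖ * Real.exp (2 * s.re) ≤ E * T := by
    have := one_add_norm_mul_exp_le hδ0 s hs0 (by rw [hsre]; exact hu1); rwa [hsim] at this
  -- powers of `q`
  have hq1 : (1 : ℝ) ≤ q := by exact_mod_cast Nat.one_le_iff_ne_zero.2 (NeZero.ne q)
  have hq0 : (0 : ℝ) < q := by linarith
  have hqC2 : (q : ℝ) ^ C * (q : ℝ) ^ 2 = (q : ℝ) ^ (C + 2) := by
    rw [Real.rpow_add hq0, Real.rpow_two]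
  have hq2le : (q : ℝ) ^ 2 ≤ (q : ℝ) ^ (C + 2) := by
    rw [← Real.rpow_two]; exact Real.rpow_le_rpow_of_exponent_le hq1 (by linarith)
  have hqC21 : (1 : ℝ) ≤ (q : ℝ) ^ (C + 2) := Real.one_le_rpow hq1 (by linarith)
  set X : ℝ := (q : ℝ) ^ (C + 2) * T with hXdef
  have hX1 : 1 ≤ X := one_le_mul_of_one_le_of_one_le hqC21 hT1
  have hX0 : 0 ≤ X := by linarith
  -- the part orthogonal to constants
  obtain ⟨hB, hperp⟩ := region_perp hA (q := q) hu0 hC hρ₀0 hρ₀1 hT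
  set CΓ : ℝ := Real.sqrt (Fintype.card (SL(2, ZMod q))) with hCΓ
  have hCΓq : CΓ ≤ (q : ℝ) ^ 2 := sqrt_card_sl_le q
  have hCΓ0 : 0 ≤ CΓ := Real.sqrt_nonneg _
  have htsum : ∑' m, C * (q : ℝ) ^ C * ρ₀ ^ m = C * (q : ℝ) ^ C * (1 - ρ₀)⁻¹ := by
    rw [tsum_mul_left, tsum_geometric_of_lt_one hρ₀0 hρ₀1]
  have hp2 := hperp η y
  rw [htsum] at hp2
  have hperp' : ‖(Ring.inverse (1 - cfTwB A hA q s) (cfTwP1 q F)) η y‖ ≤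
      (2 + 2 * (A.card : ℝ) ^ 2 + 2 * (A.card : ℝ) ^ 4 * C * (1 - ρ₀)⁻¹ * E) * X := by
    refine hp2.trans ?_
    have hρinv : 0 ≤ (1 - ρ₀)⁻¹ := inv_nonneg.2 (by linarith)
    have hinner : CΓ * 2 + 1 * (CΓ * (2 * (2 * ‖s‖ * Real.exp (2 * u)))) ≤ 2 * ((q : ℝ) ^ 2 * (E * T)) := by
      rw [← hsre]
      calc CΓ * 2 + 1 * (CΓ * (2 * (2 * ‖s‖ * Real.exp (2 * s.re)))) = 2 * (CΓ * (1 + 2 * ‖s‖ * Real.exp (2 * s.re))) := by ring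
        _ ≤ 2 * ((q : ℝ) ^ 2 * (E * T)) := by
            refine mul_le_mul_of_nonneg_left (mul_le_mul hCΓq hgrow (by positivity) (by positivity)) zero_le_two
    have e1 : (2 : ℝ) ≤ 2 * X := by linarith
    have e2 : (A.card : ℝ) ^ 2 * (CΓ * 2) ≤ 2 * (A.card : ℝ) ^ 2 * X := by
      have : CΓ * 2 ≤ 2 * X := by
        rw [hXdef]; nlinarith [mul_le_mul hq2le hT1 zero_le_one (by positivity : (0:ℝ) ≤ (q : ℝ) ^ (C + 2))]
      nlinarith [sq_nonneg (A.card : ℝ)]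
    have e3 : (A.card : ℝ) ^ 4 * (C * (q : ℝ) ^ C * (1 - ρ₀)⁻¹ * (CΓ * 2 + 1 * (CΓ * (2 * (2 * ‖s‖ * Real.exp (2 * u)))))) ≤
        2 * (A.card : ℝ) ^ 4 * C * (1 - ρ₀)⁻¹ * E * X := by
      have hc : 0 ≤ (A.card : ℝ) ^ 4 * (C * (q : ℝ) ^ C * (1 - ρ₀)⁻¹) := by positivity
      have := mul_le_mul_of_nonneg_left hinner hc
      calc (A.card : ℝ) ^ 4 * (C * (q : ℝ) ^ C * (1 - ρ₀)⁻¹ * (CΓ * 2 + 1 * (CΓ * (2 * (2 * ‖s‖ * Real.exp (2 * u))))))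
          = (A.card : ℝ) ^ 4 * (C * (q : ℝ) ^ C * (1 - ρ₀)⁻¹) * (CΓ * 2 + 1 * (CΓ * (2 * (2 * ‖s‖ * Real.exp (2 * u))))) := by ring
        _ ≤ (A.card : ℝ) ^ 4 * (C * (q : ℝ) ^ C * (1 - ρ₀)⁻¹) * (2 * ((q : ℝ) ^ 2 * (E * T))) := this
        _ = 2 * (A.card : ℝ) ^ 4 * C * (1 - ρ₀)⁻¹ * E * (((q : ℝ) ^ C * (q : ℝ) ^ 2) * T) := by ring
        _ = 2 * (A.card : ℝ) ^ 4 * C * (1 - ρ₀)⁻¹ * E * X := by rw [hqC2]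
    refine (add_le_add (add_le_add e1 e2) e3).trans (le_of_eq ?_)
    ring
  -- the scalar regular part
  have hscal : ‖(Ring.inverse (1 - cfLOp A hA s ^ 2) -
      ((s - δ)⁻¹ * (((2 * cfInt (cfNuδ A hA h2) (cfG A hA h2) : ℝ) : ℂ))⁻¹) • cfPi A hA h2) (cfTwAv q F) y‖ ≤ MX * E * X := by
    refine (CfLip.norm_apply_le _ y).trans ((ContinuousLinearMap.le_opNorm _ _).trans ?_)
    have hAv := (norm_cfTwAv_cfFamS_le (q := q) hs0).trans hgrow
    calc _ ≤ MX * (E * T) := mul_le_mul hX hAv (norm_nonneg _) hMX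
      _ ≤ MX * (E * X) := by
          apply mul_le_mul_of_nonneg_left _ hMX
          apply mul_le_mul_of_nonneg_left _ (by linarith)
          rw [hXdef]; nlinarith
      _ = MX * E * X := by ring
  rw [cfTwHop_apply_eq hA h2 hLu hB F η, CfLip.add_apply]
  calc _ ≤ ‖(Ring.inverse (1 - cfLOp A hA s ^ 2) -
        ((s - δ)⁻¹ * (((2 * cfInt (cfNuδ A hA h2) (cfG A hA h2) : ℝ) : ℂ))⁻¹) • cfPi A hA h2) (cfTwAv q F) y‖ +
        ‖(Ring.inverse (1 - cfTwB A hA q s) (cfTwP1 q F)) η y‖ := norm_add_le _ _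
    _ ≤ MX * E * X + (2 + 2 * (A.card : ℝ) ^ 2 + 2 * (A.card : ℝ) ^ 4 * C * (1 - ρ₀)⁻¹ * E) * X := add_le_add hscal hperp'
    _ = _ := by rw [hXdef]; ring

end Aux

/-! ### The main theorem -/

section Main

include hA h2 in
set_option maxHeartbeats 1600000 in
/-- **Magee–Oh–Winter uniform congruence counting for a given `Γ_A` from their Theorem 4 for that `A`.**
The hypothesis is [MageeOhWinter2019, Thm. 4] for `Γ_A`, VERBATIM in the setting of
`CFCongruenceTransferOperator.lean` (`C¹(I; ℂ^{Γ_q})` with the Hermitian fibre norm, eq. (2.3); `τ = log|T'|`;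
the paper's convention for `ρ`): write `s = a + ib`; there is `Q₀ ∈ ℕ` such that for any `η > 0` there are
`ε(η), b₀ > 0`, `0 < ρ_η < 1`, `C_η > 0`, `0 < ρ₀ < 1`, `C > 0` with, for `|a - δ_A| < ε`:
(1) `|b| ≤ b₀`, `(q, Q₀) = 1`, `f ∈ C¹(I; ℂ^{Γ_q} ⊖ 1)`: `‖𝓛^m_{s,q} f‖_{C¹} ≤ C q^C ρ₀^m ‖f‖_{C¹}`;
(2) `|b| > b₀`: `‖𝓛^m_{s,q}‖_{C¹} ≤ C_η |b|^{1+η} ρ_η^m` for all `q`. The conclusion is the `A`-instance of the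
named fact `MageeOhWinter2019_uniformCounting` ([MageeOhWinter2019, Thm. 1, Thm. 2, Thm. 11 with `G ≡ 1`,
`γ₀ = e`]). Proof: §3 of the paper as formalised in the tree (`uniformCounting_of_operatorBounds`) plus this
file's region-by-region verification of its resolvent hypotheses.
[cite: MageeOhWinter2019, Thm. 1, Thm. 2, Thm. 4 and §3.4] -/
theorem MageeOhWinter2019_uniformCounting_at_of_transferOperatorBounds
    (hT4A : ∃ Q₀ : ℕ, 0 < Q₀ ∧ ∀ η : ℝ, 0 < η →
        ∃ ε : ℝ, 0 < ε ∧ ∃ b₀ : ℝ, 0 < b₀ ∧ ∃ ρη : ℝ, 0 < ρη ∧ ρη < 1 ∧ ∃ Cη : ℝ, 0 < Cη ∧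
          ∃ ρ₀ : ℝ, 0 < ρ₀ ∧ ρ₀ < 1 ∧ ∃ C : ℝ, 0 < C ∧
            ∀ a b : ℝ, |a - cfDimension A| < ε →
              (|b| ≤ b₀ → ∀ (q : ℕ) [NeZero q], Nat.Coprime q Q₀ →
                  ∀ F : ℝ → CfVec q, ContDiffOn ℝ 1 F (cfI A) → (∀ x ∈ cfI A, ∑ ξ, F x ξ = 0) →
                    ∀ m : ℕ, c1NormOn (cfI A) ((cfCongL A q (a + b * Complex.I))^[m] F) ≤
                      C * (q : ℝ) ^ C * ρ₀ ^ m * c1NormOn (cfI A) F) ∧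
              (b₀ < |b| → ∀ (q : ℕ) [NeZero q],
                  ∀ F : ℝ → CfVec q, ContDiffOn ℝ 1 F (cfI A) →
                    ∀ m : ℕ, c1NormOn (cfI A) ((cfCongL A q (a + b * Complex.I))^[m] F) ≤
                      Cη * |b| ^ (1 + η) * ρη ^ m * c1NormOn (cfI A) F)) :
    0 < cfDimension A ∧
    ∃ Q₀ : ℕ, 0 < Q₀ ∧ ∃ c : ℝ, 0 < c ∧ ∃ C : ℝ, 0 < C ∧ ∃ ε : ℝ, 0 < ε ∧ ∃ K : ℝ, 0 ≤ K ∧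
      ∀ q : ℕ, 0 < q → Nat.Coprime q Q₀ → ∀ (ξ : SL(2, ZMod q)) (R : ℝ), 1 ≤ R →
        |(cfCount A q ξ R : ℝ) - c * R ^ (2 * cfDimension A) / (Nat.card (SL(2, ZMod q)) : ℝ)| ≤
          K * (q : ℝ) ^ C * R ^ (2 * cfDimension A - ε) := by
  obtain ⟨Q₀, hQ₀, hη⟩ := hT4A
  obtain ⟨ε, hε, b₀, hb₀, ρ, hρ0, hρ1, Cη, hCη, ρ₀, hρ₀0, hρ₀1, C, hC, hmain⟩ := hη 1 one_pos
  set δ : ℝ := cfDimension A with hδ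
  have hδ0 : 0 < δ := cfDimension_pos hA h2
  have hne := nonempty_of_two_le_card h2
  obtain ⟨a₀, ha₀, b₁, hb₁, hab⟩ := exists_ne_of_two_le_card (A := A) h2
  -- the scalar strip
  obtain ⟨ε₁, hε₁, MX, hMX, hstrip⟩ := exists_strip_regular_bound hA h2 b₀
  obtain ⟨ε₂, hε₂, hunits⟩ := exists_strip_isUnit_cfLOp hA h2 b₀
  -- pressure smallness
  set ℓ : ℝ := -Real.log ρ with hℓ
  have hℓ0 : 0 < ℓ := by rw [hℓ]; exact neg_pos.2 (Real.log_neg hρ0 hρ1)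
  set Lp : ℝ := 2 * Real.log ((cfAmax A : ℝ) + 1) with hLp
  have hLp0 : 0 ≤ Lp := by
    rw [hLp]; exact mul_nonneg zero_le_two (Real.log_nonneg (by linarith [Nat.cast_nonneg (α := ℝ) (cfAmax A)]))
  set τ : ℝ := ℓ / (8 * (Lp + 1)) with hτ
  have hτ0 : 0 < τ := by positivity
  set μ : ℝ := min (min (ε / 2) (min ε₁ ε₂)) (min τ (δ / 2)) with hμ
  have hμ0 : 0 < μ := by positivity
  have hμε : μ ≤ ε / 2 := (min_le_left _ _).trans (min_le_left _ _)
  have hμ1 : μ ≤ ε₁ := (min_le_left _ _).trans ((min_le_right _ _).trans (min_le_left _ _))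
  have hμ2 : μ ≤ ε₂ := (min_le_left _ _).trans ((min_le_right _ _).trans (min_le_right _ _))
  have hμτ : μ ≤ τ := (min_le_right _ _).trans (min_le_left _ _)
  have hμδ : μ ≤ δ / 2 := (min_le_right _ _).trans (min_le_right _ _)
  set σ₀ : ℝ := δ - μ with hσ₀
  set σ₁ : ℝ := δ - μ / 2 with hσ₁
  have hσ₀0 : 0 ≤ σ₀ := by rw [hσ₀]; linarith
  have hσ₀₁ : σ₀ < σ₁ := by rw [hσ₀, hσ₁]; linarith
  have hσ₁δ : σ₁ < δ := by rw [hσ₁]; linarith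
  have hσ₁0 : 0 ≤ σ₁ := by linarith
  -- `p = P(σ₁)`: `0 ≤ p`, `8p ≤ ℓ`
  set p : ℝ := cfPressure A σ₁ with hp
  have hPδ : cfPressure A δ = 0 := cfPressure_cfDimension hA h2
  have hBmax : ∀ a ∈ A, a ≤ cfAmax A := fun a ha => le_cfAmax ha
  have hp0 : 0 ≤ p := by
    have := cfPressure_antitoneOn hA hne (show (σ₁ : ℝ) ∈ Ici 0 from hσ₁0) (show (δ : ℝ) ∈ Ici 0 from hδ0.le) hσ₁δ.le
    rw [hPδ] at this; exact this
  have hp8 : 8 * p ≤ ℓ := by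
    have hlip := abs_cfPressure_sub_le hA hne hBmax hδ0.le hσ₁0
    rw [hPδ, sub_zero] at hlip
    have h1 : p ≤ Lp * (μ / 2) := by
      have : |σ₁ - δ| = μ / 2 := by rw [hσ₁, show δ - μ / 2 - δ = -(μ / 2) by ring, abs_neg, abs_of_pos (by positivity)]
      rw [this] at hlip
      exact (le_abs_self _).trans hlip
    have h2' : Lp * (μ / 2) ≤ Lp * τ := by nlinarith
    have h3 : Lp * τ ≤ ℓ / 8 := by
      rw [hτ, mul_div_assoc', div_le_div_iff₀ (by positivity) (by norm_num)]
      nlinarith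
    linarith
  -- antitonicity of `λ`
  have hPmono : ∀ u v : ℝ, 0 ≤ u → u ≤ v → cfPressure A v ≤ cfPressure A u := fun u v hu huv =>
    cfPressure_antitoneOn hA hne (show u ∈ Ici 0 from hu) (show v ∈ Ici 0 from hu.trans huv) huv
  have hEigmono : ∀ u v : ℝ, 0 ≤ u → u ≤ v → cfEig A v ≤ cfEig A u := fun u v hu huv =>
    Real.exp_le_exp.2 (hPmono u v hu huv)
  -- Theorem 4 data in the two regimes, for `s` with `|Re s - δ| < ε`
  have hT2 : ∀ s : ℂ, |s.re - δ| < ε → b₀ < |s.im| → ∀ (q : ℕ) [NeZero q], ∀ F : ℝ → CfVec q, ContDiffOn ℝ 1 F (cfI A) →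
      ∀ m : ℕ, c1NormOn (cfI A) ((cfCongL A q ((s.re : ℂ) + s.im * I))^[m] F) ≤
        Cη * |s.im| ^ (1 + (1 : ℝ)) * ρ ^ m * c1NormOn (cfI A) F :=
    fun s hs hb q _ => (hmain s.re s.im hs).2 hb q
  have hT1 : ∀ s : ℂ, |s.re - δ| < ε → |s.im| ≤ b₀ → ∀ (q : ℕ) [NeZero q], Nat.Coprime q Q₀ →
      ∀ F : ℝ → CfVec q, ContDiffOn ℝ 1 F (cfI A) → (∀ x ∈ cfI A, ∑ ξ, F x ξ = 0) →
      ∀ m : ℕ, c1NormOn (cfI A) ((cfCongL A q ((s.re : ℂ) + s.im * I))^[m] F) ≤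
        C * (q : ℝ) ^ C * ρ₀ ^ m * c1NormOn (cfI A) F :=
    fun s hs hb q _ hq => (hmain s.re s.im hs).1 hb q hq
  have hsdec : ∀ s : ℂ, s = (s.re : ℂ) + s.im * I := fun s => (re_add_im s).symm
  -- (hL1), (hL2)
  have hL12 : ∀ s : ℂ, σ₀ < s.re → IsUnit (1 + cfLOp A hA s) ∧ (s ≠ (δ : ℂ) → IsUnit (1 - cfLOp A hA s)) := by
    intro s hs
    by_cases hre : δ ≤ s.re
    · exact ⟨isUnit_one_add_cfLOp A hA h2 hre, fun hne' => isUnit_one_sub_cfLOp A hA h2 hre hne'⟩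
    · have hre' : s.re < δ := not_le.1 hre
      have habs : |s.re - δ| < ε := by rw [abs_sub_comm, abs_of_pos (by linarith)]; rw [hσ₀] at hs; linarith
      by_cases hb : |s.im| ≤ b₀
      · have h := hunits s (by rw [hσ₀] at hs; linarith) hb
        exact ⟨h.1, h.2⟩
      · have hb' : b₀ < |s.im| := not_le.1 hb
        have hs0 : 0 ≤ s.re := by linarith
        have hβ := thm4_large_bounds hA (q := 1) hCη.le hρ0.le (hT2 s habs hb' 1)
        have hB0 : ∀ m, 0 ≤ Cη * |s.im| ^ (2 : ℝ) * ρ ^ m := fun m => by positivity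
        have hBs : Summable fun m => Cη * |s.im| ^ (2 : ℝ) * ρ ^ m := (summable_geometric_of_lt_one hρ0.le hρ1).mul_left _
        have hs0' : 0 ≤ ((s.re : ℂ) + s.im * I).re := by simpa using hs0
        obtain ⟨-, hm, hp'⟩ := isUnit_one_sub_cfLOp_of_bounds hA hs0' one_pos hB0 hBs hβ
        rw [← hsdec s] at hm hp'
        exact ⟨hp', fun _ => hm⟩
  have hL1 : ∀ s : ℂ, σ₀ < s.re → s ≠ (cfDimension A : ℂ) → IsUnit (1 - cfLOp A hA s) := fun s hs hne' => (hL12 s hs).2 hne'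
  have hL2 : ∀ s : ℂ, σ₀ < s.re → IsUnit (1 + cfLOp A hA s) := fun s hs => (hL12 s hs).1
  -- (hBq)
  have hBq : ∀ (q : ℕ) [NeZero q], Nat.Coprime q Q₀ → ∀ s : ℂ, σ₀ < s.re → IsUnit (1 - cfTwB A hA q s) := by
    intro q _ hq s hs
    by_cases hre : δ < s.re
    · exact isUnit_one_sub_cfTwB_of_isUnit hA q (isUnit_one_sub_cfTwist_of_lt A hA h2 q hre).2
    · have hre' : s.re ≤ δ := not_lt.1 hre
      have habs : |s.re - δ| < ε := by
        rw [abs_sub_comm, abs_of_nonneg (by linarith)]; rw [hσ₀] at hs; linarith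
      have hs0 : 0 ≤ s.re := by linarith
      by_cases hb : |s.im| ≤ b₀
      · have h := (region_perp hA (q := q) hs0 hC.le hρ₀0.le hρ₀1 (hT1 s habs hb q hq)).1
        rwa [← hsdec s] at h
      · have h := (region_large hA h2 (q := q) hs0 hCη.le hρ0.le hρ1 (hT2 s habs (not_le.1 hb) q)).1
        rw [← hsdec s] at h
        exact isUnit_one_sub_cfTwB_of_isUnit hA q h
  -- constants for (hopq)
  set lamS : ℝ := cfEig A (δ + ε / 2) with hlamS
  have hlamS1 : lamS < 1 := cfEig_lt_one_of_lt A hA h2 (by rw [← hδ]; linarith)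
  have hlamS0 : 0 < lamS := cfEig_pos _
  set E : ℝ := 2 * Real.exp (2 * (δ + 1)) * (δ + 2) + 1 with hE
  have hE0 : 0 ≤ E := by positivity
  set Kres : ℝ := ‖((((2 * cfInt (cfNuδ A hA h2) (cfG A hA h2) : ℝ)) : ℂ))⁻¹‖ * ‖cfPi A hA h2‖ with hKres
  have hKres0 : 0 ≤ Kres := by positivity
  have hResle : ∀ (q : ℕ) [NeZero q], ‖cfTwResOp A hA h2 q‖ ≤ Kres := fun q _ => norm_cfTwResOp_le hA h2 (q := q)
  have hgap0 : 0 ≤ (1 - lamS ^ 2)⁻¹ := inv_nonneg.2 (by nlinarith)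
  have hρinv : 0 ≤ (1 - ρ)⁻¹ := inv_nonneg.2 (by linarith)
  have hρ₀inv : 0 ≤ (1 - ρ₀)⁻¹ := inv_nonneg.2 (by linarith)
  have hℓinv : 0 ≤ 1 + 8 / ℓ := by positivity
  have hKfar0 : 0 ≤ ((4 : ℝ) ^ (δ + 1) * (1 - lamS ^ 2)⁻¹ + (ε / 2)⁻¹ * Kres) * E := by positivity
  have hH0 : 0 ≤ (1 + 8 / ℓ) * Real.exp (2 * p) := by positivity
  have hcA : 0 ≤ (A.card : ℝ) := Nat.cast_nonneg _
  have h4pos : 0 ≤ (4 : ℝ) ^ (δ + 1) := by positivity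
  have hKbig0 : 0 ≤ (1 + (A.card : ℝ) ^ 2 + (A.card : ℝ) ^ 4 * ((4 : ℝ) ^ (δ + 1) * ((1 + 8 / ℓ) * Real.exp (2 * p)) +
      2 * Cη ^ 2 * (1 - ρ)⁻¹ * E)) + b₀⁻¹ * Kres * E :=
    add_nonneg (add_nonneg (add_nonneg zero_le_one (pow_nonneg hcA 2)) (mul_nonneg (pow_nonneg hcA 4)
      (add_nonneg (mul_nonneg h4pos hH0) (mul_nonneg (mul_nonneg (mul_nonneg zero_le_two (sq_nonneg _)) hρinv) hE0))))
      (mul_nonneg (mul_nonneg (inv_nonneg.2 hb₀.le) hKres0) hE0)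
  have hKsmall0 : 0 ≤ MX * E + 2 + 2 * (A.card : ℝ) ^ 2 + 2 * (A.card : ℝ) ^ 4 * C * (1 - ρ₀)⁻¹ * E :=
    add_nonneg (add_nonneg (add_nonneg (mul_nonneg hMX hE0) zero_le_two) (mul_nonneg zero_le_two (pow_nonneg hcA 2)))
      (mul_nonneg (mul_nonneg (mul_nonneg (mul_nonneg zero_le_two (pow_nonneg hcA 4)) hC.le) hρ₀inv) hE0)
  set Kfar : ℝ := ((4 : ℝ) ^ (δ + 1) * (1 - lamS ^ 2)⁻¹ + (ε / 2)⁻¹ * Kres) * E with hKfar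
  set H : ℝ := (1 + 8 / ℓ) * Real.exp (2 * p) with hH
  set Kbig : ℝ := (1 + (A.card : ℝ) ^ 2 + (A.card : ℝ) ^ 4 * ((4 : ℝ) ^ (δ + 1) * H + 2 * Cη ^ 2 * (1 - ρ)⁻¹ * E)) +
    b₀⁻¹ * Kres * E with hKbig
  set Ksmall : ℝ := MX * E + 2 + 2 * (A.card : ℝ) ^ 2 + 2 * (A.card : ℝ) ^ 4 * C * (1 - ρ₀)⁻¹ * E with hKsmall
  have hKc0 : 0 ≤ Kfar + Kbig + Ksmall := add_nonneg (add_nonneg hKfar0 hKbig0) hKsmall0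
  set Kc : ℝ := Kfar + Kbig + Ksmall with hKc
  -- (hopq)
  have hopq : ∀ (q : ℕ) [NeZero q], Nat.Coprime q Q₀ → ∀ u : ℝ, σ₁ ≤ u → u ≤ cfDimension A + 1 → ∀ t : ℝ,
      (u : ℂ) + t * I ≠ (cfDimension A : ℂ) → ∀ (η : SL(2, ZMod q)) (y : Icc (0 : ℝ) 1),
        ‖(cfTwHop A hA h2 q ((u : ℂ) + t * I) (cfFamS q cfΘ₀ (CfLip.const 1) 1 ((u : ℂ) + t * I))) η y‖ ≤
          Kc * (q : ℝ) ^ (C + 2) * (1 + |t|) ^ (3 / 2 : ℝ) := by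
    intro q _ hq u hσu hu1 t hne' η y
    have hu0 : 0 ≤ u := hσ₁0.trans hσu
    set T : ℝ := 1 + |t| with hTdef
    have hT1 : 1 ≤ T := by rw [hTdef]; linarith [abs_nonneg t]
    have hT32 : T ≤ T ^ (3 / 2 : ℝ) := by
      have := Real.rpow_le_rpow_of_exponent_le hT1 (show (1 : ℝ) ≤ 3 / 2 by norm_num); rwa [Real.rpow_one] at this
    have hT320 : 0 ≤ T ^ (3 / 2 : ℝ) := by positivity
    have hq1 : (1 : ℝ) ≤ q := by exact_mod_cast Nat.one_le_iff_ne_zero.2 (NeZero.ne q)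
    have hqC : (1 : ℝ) ≤ (q : ℝ) ^ (C + 2) := Real.one_le_rpow hq1 (by linarith)
    have hq2 : (q : ℝ) ^ 2 ≤ (q : ℝ) ^ (C + 2) := by
      rw [← Real.rpow_two]; exact Real.rpow_le_rpow_of_exponent_le hq1 (by linarith)
    set X : ℝ := (q : ℝ) ^ (C + 2) * T ^ (3 / 2 : ℝ) with hX
    have hX1 : 1 ≤ X := one_le_mul_of_one_le_of_one_le hqC (hT1.trans hT32)
    have hX0 : 0 ≤ X := by linarith
    have hfinal : ∀ {v K : ℝ}, v ≤ K * X → 0 ≤ K → K ≤ Kc → v ≤ Kc * (q : ℝ) ^ (C + 2) * (1 + |t|) ^ (3 / 2 : ℝ) := by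
      intro v K hv hK hKle
      calc v ≤ K * X := hv
        _ ≤ Kc * X := mul_le_mul_of_nonneg_right hKle hX0
        _ = _ := by rw [hX]; ring
    by_cases hfar : δ + ε / 2 ≤ u
    · -- far from `δ`
      have h := hop_bound_far hA h2 (q := q) hε hfar hu1 (t := t) η y
      refine hfinal (K := Kfar) (h.trans ?_) hKfar0 (by rw [hKc]; linarith)
      have hc : ((4 : ℝ) ^ (δ + 1) * (1 - lamS ^ 2)⁻¹ + (ε / 2)⁻¹ * ‖cfTwResOp A hA h2 q‖) ≤
          ((4 : ℝ) ^ (δ + 1) * (1 - lamS ^ 2)⁻¹ + (ε / 2)⁻¹ * Kres) :=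
        add_le_add le_rfl (mul_le_mul_of_nonneg_left (hResle q) (by positivity))
      calc _ ≤ ((4 : ℝ) ^ (δ + 1) * (1 - lamS ^ 2)⁻¹ + (ε / 2)⁻¹ * Kres) * (E * T) :=
            mul_le_mul_of_nonneg_right hc (by positivity)
        _ = Kfar * T := by rw [hKfar]; ring
        _ ≤ Kfar * X := by
            apply mul_le_mul_of_nonneg_left _ hKfar0
            calc T ≤ 1 * T ^ (3 / 2 : ℝ) := by rw [one_mul]; exact hT32
              _ ≤ X := mul_le_mul_of_nonneg_right hqC hT320
    · have hu' : u < δ + ε / 2 := not_le.1 hfar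
      have habs : |u - δ| < ε := by
        have h1 : δ - ε / 2 < u := by have := hσu; rw [hσ₁] at this; linarith
        rw [abs_lt]; constructor <;> linarith
      by_cases hb : b₀ < |t|
      · -- large `|Im s|`
        have hT := (hmain u t habs).2 hb q
        have h := hop_bound_bigT hA h2 (q := q) hb₀ hCη.le hρ0 hρ1 hp0 hp8 hσ₁0 rfl hσu hu1 hb hT η y
        refine hfinal (K := Kbig) (h.trans ?_) hKbig0 (by rw [hKc]; linarith)
        have hc : (1 + (A.card : ℝ) ^ 2 + (A.card : ℝ) ^ 4 * ((4 : ℝ) ^ (δ + 1) * H + 2 * Cη ^ 2 * (1 - ρ)⁻¹ * E)) +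
            b₀⁻¹ * ‖cfTwResOp A hA h2 q‖ * E ≤ Kbig := by
          rw [hKbig]
          have := mul_le_mul_of_nonneg_left (hResle q) (by positivity : (0:ℝ) ≤ b₀⁻¹)
          nlinarith [hE0]
        calc _ ≤ Kbig * (q : ℝ) ^ 2 * T ^ (3 / 2 : ℝ) := by
              apply mul_le_mul_of_nonneg_right (mul_le_mul_of_nonneg_right hc (by positivity)) hT320
          _ ≤ Kbig * (q : ℝ) ^ (C + 2) * T ^ (3 / 2 : ℝ) := by
              apply mul_le_mul_of_nonneg_right (mul_le_mul_of_nonneg_left hq2 hKbig0) hT320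
          _ = Kbig * X := by rw [hX]; ring
      · -- bounded `|Im s|`: decomposition
        have ht : |t| ≤ b₀ := not_lt.1 hb
        have hT := (hmain u t habs).1 ht q hq
        have hsu : δ - ε₁ ≤ ((u : ℂ) + t * I).re := by
          have h1 : ((u : ℂ) + t * I).re = u := by simp
          rw [h1]; have := hσu; rw [hσ₁] at this; linarith
        have him : |((u : ℂ) + t * I).im| ≤ b₀ := by
          have h1 : ((u : ℂ) + t * I).im = t := by simp
          rw [h1]; exact ht
        have hre1 : ((u : ℂ) + t * I).re ≤ δ + 1 := by
          have h1 : ((u : ℂ) + t * I).re = u := by simp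
          rw [h1]; exact hu1
        obtain ⟨-, -, hLu, hXb⟩ := hstrip ((u : ℂ) + t * I) hsu hre1 him hne'
        have h := hop_bound_smallT hA h2 (q := q) hC.le hρ₀0.le hρ₀1 hMX hu0 hu1 hLu hXb hT η y
        refine hfinal (K := Ksmall) (h.trans ?_) hKsmall0 (by rw [hKc]; linarith)
        calc Ksmall * (q : ℝ) ^ (C + 2) * (1 + |t|) = Ksmall * ((q : ℝ) ^ (C + 2) * T) := by rw [hTdef]; ring
          _ ≤ Ksmall * X := by
              apply mul_le_mul_of_nonneg_left _ hKsmall0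
              rw [hX]; exact mul_le_mul_of_nonneg_left hT32 (by positivity)
  exact uniformCounting_of_operatorBounds hA h2 ha₀ hb₁ hab hσ₀0 hσ₀₁ hσ₁δ (by norm_num : (0 : ℝ) ≤ 3 / 2)
    (by norm_num : (3 / 2 : ℝ) < 2) hKc0 (by linarith : (0 : ℝ) ≤ C + 2) hQ₀ hL1 hL2 hBq hopq

/-- **Magee–Oh–Winter uniform congruence counting for `Γ_A` from their Theorem 4.** The hypothesis is
[MageeOhWinter2019, Thm. 4] for `Γ_A` (all admissible `A`), VERBATIM in the setting of
`CFCongruenceTransferOperator.lean` (`C¹(I; ℂ^{Γ_q})` with the Hermitian fibre norm, eq. (2.3); `τ = log|T'|`;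
the paper's convention for `ρ`): write `s = a + ib`; for every finite set `A` of `≥ 2` positive integers there
is `Q₀ ∈ ℕ` such that for any `η > 0` there are `ε(η), b₀ > 0`, `0 < ρ_η < 1`, `C_η > 0`, `0 < ρ₀ < 1`, `C > 0`
with, for `|a - δ_A| < ε`: (1) `|b| ≤ b₀`, `(q, Q₀) = 1`, `f ∈ C¹(I; ℂ^{Γ_q} ⊖ 1)`:
`‖𝓛^m_{s,q} f‖_{C¹} ≤ C q^C ρ₀^m ‖f‖_{C¹}`; (2) `|b| > b₀`: `‖𝓛^m_{s,q}‖_{C¹} ≤ C_η |b|^{1+η} ρ_η^m` for all `q`.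
The conclusion is the named fact `MageeOhWinter2019_uniformCounting` ([MageeOhWinter2019, Thm. 1, Thm. 2,
Thm. 11 with `G ≡ 1`, `γ₀ = e`]). [cite: MageeOhWinter2019, Thm. 1, Thm. 2, Thm. 4 and §3.4] -/
theorem MageeOhWinter2019_uniformCounting_of_transferOperatorBounds
    (hT4 : ∀ A : Finset ℕ, (∀ a ∈ A, 1 ≤ a) → 2 ≤ A.card →
      ∃ Q₀ : ℕ, 0 < Q₀ ∧ ∀ η : ℝ, 0 < η →
        ∃ ε : ℝ, 0 < ε ∧ ∃ b₀ : ℝ, 0 < b₀ ∧ ∃ ρη : ℝ, 0 < ρη ∧ ρη < 1 ∧ ∃ Cη : ℝ, 0 < Cη ∧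
          ∃ ρ₀ : ℝ, 0 < ρ₀ ∧ ρ₀ < 1 ∧ ∃ C : ℝ, 0 < C ∧
            ∀ a b : ℝ, |a - cfDimension A| < ε →
              (|b| ≤ b₀ → ∀ (q : ℕ) [NeZero q], Nat.Coprime q Q₀ →
                  ∀ F : ℝ → CfVec q, ContDiffOn ℝ 1 F (cfI A) → (∀ x ∈ cfI A, ∑ ξ, F x ξ = 0) →
                    ∀ m : ℕ, c1NormOn (cfI A) ((cfCongL A q (a + b * Complex.I))^[m] F) ≤
                      C * (q : ℝ) ^ C * ρ₀ ^ m * c1NormOn (cfI A) F) ∧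
              (b₀ < |b| → ∀ (q : ℕ) [NeZero q],
                  ∀ F : ℝ → CfVec q, ContDiffOn ℝ 1 F (cfI A) →
                    ∀ m : ℕ, c1NormOn (cfI A) ((cfCongL A q (a + b * Complex.I))^[m] F) ≤
                      Cη * |b| ^ (1 + η) * ρη ^ m * c1NormOn (cfI A) F)) :
    MageeOhWinter2019_uniformCounting := fun A hA h2 =>
  MageeOhWinter2019_uniformCounting_at_of_transferOperatorBounds hA h2 (hT4 A hA h2)

end Main

/-! ### Level one: the expander-free part -/

section LevelOne

/-- `(𝓛_{s,q})^m 0 = 0`. [folklore] -/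
theorem cfCongL_iterate_zero (s : ℂ) (m : ℕ) : (cfCongL A q s)^[m] (0 : ℝ → CfVec q) = 0 := by
  induction m with
  | zero => rfl
  | succ m ih =>
    rw [Function.iterate_succ_apply', ih]
    exact funext fun x => cfCongL_zero A s x

/-- **At level `q = 1` Theorem 4 (1) is vacuous:** `Γ_1` is trivial, so `ℂ^{Γ_1} ⊖ 1 = 0` — a function with
values orthogonal to the constants vanishes on `I`, hence so do all `𝓛^m F` and both sides of the bound (for
any constants `C, ρ₀ ≥ 0`). [folklore] -/
theorem thm4_part1_levelOne (hA : ∀ a ∈ A, 1 ≤ a) (s : ℂ) {C ρ₀ : ℝ} (hC : 0 ≤ C) (hρ₀ : 0 ≤ ρ₀) :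
    ∀ F : ℝ → CfVec 1, ContDiffOn ℝ 1 F (cfI A) → (∀ x ∈ cfI A, ∑ ξ, F x ξ = 0) → ∀ m : ℕ,
      c1NormOn (cfI A) ((cfCongL A 1 s)^[m] F) ≤ C * ((1 : ℕ) : ℝ) ^ C * ρ₀ ^ m * c1NormOn (cfI A) F := by
  intro F _ hF0 m
  have hzero : ∀ x ∈ cfI A, F x = 0 := fun x hx => by
    have h := hF0 x hx
    rw [Fintype.sum_subsingleton _ (1 : SL(2, ZMod 1))] at h
    ext ξ
    rw [Subsingleton.elim ξ 1, h]
    rfl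
  have hiter : ∀ x ∈ cfI A, (cfCongL A 1 s)^[m] F x = 0 := fun x hx => by
    rw [cfCongL_iterate_congr_of_eqOn A hA s (G := 0) (fun y hy => hzero y hy) m hx, cfCongL_iterate_zero]
    rfl
  have hderiv : ∀ x ∈ cfI A, derivWithin ((cfCongL A 1 s)^[m] F) (cfI A) x = 0 := fun x hx => by
    rw [derivWithin_congr (f := fun _ : ℝ => (0 : CfVec 1)) (fun y hy => hiter y hy) (hiter x hx)]
    simp
  have hL : c1NormOn (cfI A) ((cfCongL A 1 s)^[m] F) ≤ 0 + 0 :=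
    c1NormOn_le_of_bounds le_rfl le_rfl (fun x hx => by rw [hiter x hx, norm_zero]) (fun x hx => by rw [hderiv x hx, norm_zero])
  have hR : 0 ≤ C * ((1 : ℕ) : ℝ) ^ C * ρ₀ ^ m * c1NormOn (cfI A) F := by
    have := c1NormOn_nonneg (cfI A) F
    have h1 : 0 ≤ ((1 : ℕ) : ℝ) ^ C := Real.rpow_nonneg (by norm_num) _
    positivity
  linarith

/-- At level `q = 1` the projection onto the part orthogonal to constants vanishes. [folklore] -/
theorem cfTwP1_levelOne (G : SL(2, ZMod 1) → CfLip) : cfTwP1 1 G = 0 := by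
  funext ξ
  have hcard : (Fintype.card (SL(2, ZMod 1)) : ℂ) = 1 := by
    rw [Fintype.card_eq_one_iff.2 ⟨1, fun ξ => Subsingleton.elim _ _⟩, Nat.cast_one]
  rw [cfTwP1_apply', cfTwAv_apply, Fintype.sum_subsingleton _ ξ, hcard, inv_one, one_smul, sub_self]
  rfl

/-- At level `q = 1`, `B_s = 𝓜_s P₁ = 0`, so `1 - B_s` is a unit. [folklore] -/
theorem isUnit_one_sub_cfTwB_levelOne (s : ℂ) : IsUnit (1 - cfTwB A hA 1 s) := by
  have h : cfTwB A hA 1 s = 0 := by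
    refine ContinuousLinearMap.ext fun G => ?_
    show cfTwist A hA 1 s (cfTwP1 1 G) = 0
    rw [cfTwP1_levelOne, map_zero]
  rw [h, sub_zero]
  exact isUnit_one

include hA h2 in
set_option maxHeartbeats 1600000 in
/-- **The expander-free part: power saving for the total count from the Dolgopyat bound alone.**
If the pair transfer operator of `Γ_A` satisfies the LARGE-`|Im s|` bound of [MageeOhWinter2019, Thm. 4 (2)]
at level `q = 1` (Prop. 21 at `q = 1`: a Naud-type Dolgopyat estimate `‖𝓛^m_{s,1}‖_{C¹(I)} ≤ C_η |b|^{1+η} ρ_η^m`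
for `|Re s - δ_A| < ε(η)`, `|Im s| > b₀`, all `m`), then the TOTAL count satisfies
`|#{γ ∈ Γ_A : ‖γ‖ ≤ R} - c R^{2δ_A}| ≤ K R^{2δ_A - ε'}` for `R ≥ 1` ([MageeOhWinter2019, Thm. 2 at `q = 1`]).
This isolates Theorem 4 (1) — the expansion input (Bourgain–Gamburd–Sarnak, Bourgain–Varjú, appendix) —
as the only ingredient of the named fact that is specific to uniformity in the level: at `q = 1`, part (1)
is vacuous (`thm4_part1_levelOne`) and `1 - B_s = 1`. [cite: MageeOhWinter2019, Thm. 2, Thm. 4 (2), Prop. 21 and §3.4] -/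
theorem MageeOhWinter2019_totalCount_powerSaving_of_dolgopyatBounds
    (hD : ∀ η : ℝ, 0 < η → ∃ ε : ℝ, 0 < ε ∧ ∃ b₀ : ℝ, 0 < b₀ ∧ ∃ ρη : ℝ, 0 < ρη ∧ ρη < 1 ∧ ∃ Cη : ℝ, 0 < Cη ∧
      ∀ a b : ℝ, |a - cfDimension A| < ε → b₀ < |b| →
        ∀ F : ℝ → CfVec 1, ContDiffOn ℝ 1 F (cfI A) →
          ∀ m : ℕ, c1NormOn (cfI A) ((cfCongL A 1 (a + b * Complex.I))^[m] F) ≤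
            Cη * |b| ^ (1 + η) * ρη ^ m * c1NormOn (cfI A) F) :
    ∃ c : ℝ, 0 < c ∧ ∃ ε : ℝ, 0 < ε ∧ ∃ K : ℝ, 0 ≤ K ∧ ∀ R : ℝ, 1 ≤ R →
      |(cfCount A 1 1 R : ℝ) - c * R ^ (2 * cfDimension A)| ≤ K * R ^ (2 * cfDimension A - ε) := by
  obtain ⟨ε, hε, b₀, hb₀, ρ, hρ0, hρ1, Cη, hCη, hmain⟩ := hD 1 one_pos
  set δ : ℝ := cfDimension A with hδ
  have hδ0 : 0 < δ := cfDimension_pos hA h2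
  have hne := nonempty_of_two_le_card h2
  obtain ⟨a₀, ha₀, b₁, hb₁, -⟩ := exists_ne_of_two_le_card (A := A) h2
  -- the scalar strip
  obtain ⟨ε₁, hε₁, MX, hMX, hstrip⟩ := exists_strip_regular_bound hA h2 b₀
  obtain ⟨ε₂, hε₂, hunits⟩ := exists_strip_isUnit_cfLOp hA h2 b₀
  -- pressure smallness
  set ℓ : ℝ := -Real.log ρ with hℓ
  have hℓ0 : 0 < ℓ := by rw [hℓ]; exact neg_pos.2 (Real.log_neg hρ0 hρ1)
  set Lp : ℝ := 2 * Real.log ((cfAmax A : ℝ) + 1) with hLp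
  have hLp0 : 0 ≤ Lp := by
    rw [hLp]; exact mul_nonneg zero_le_two (Real.log_nonneg (by linarith [Nat.cast_nonneg (α := ℝ) (cfAmax A)]))
  set τ : ℝ := ℓ / (8 * (Lp + 1)) with hτ
  have hτ0 : 0 < τ := by positivity
  set μ : ℝ := min (min (ε / 2) (min ε₁ ε₂)) (min τ (δ / 2)) with hμ
  have hμ0 : 0 < μ := by positivity
  have hμε : μ ≤ ε / 2 := (min_le_left _ _).trans (min_le_left _ _)
  have hμ1 : μ ≤ ε₁ := (min_le_left _ _).trans ((min_le_right _ _).trans (min_le_left _ _))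
  have hμ2 : μ ≤ ε₂ := (min_le_left _ _).trans ((min_le_right _ _).trans (min_le_right _ _))
  have hμτ : μ ≤ τ := (min_le_right _ _).trans (min_le_left _ _)
  have hμδ : μ ≤ δ / 2 := (min_le_right _ _).trans (min_le_right _ _)
  set σ₀ : ℝ := δ - μ with hσ₀
  set σ₁ : ℝ := δ - μ / 2 with hσ₁
  have hσ₀0 : 0 ≤ σ₀ := by rw [hσ₀]; linarith
  have hσ₀₁ : σ₀ < σ₁ := by rw [hσ₀, hσ₁]; linarith
  have hσ₁δ : σ₁ < δ := by rw [hσ₁]; linarith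
  have hσ₁0 : 0 ≤ σ₁ := by linarith
  have hσ₁pos : 0 < σ₁ := lt_of_le_of_lt hσ₀0 hσ₀₁
  set p : ℝ := cfPressure A σ₁ with hp
  have hPδ : cfPressure A δ = 0 := cfPressure_cfDimension hA h2
  have hBmax : ∀ a ∈ A, a ≤ cfAmax A := fun a ha => le_cfAmax ha
  have hp0 : 0 ≤ p := by
    have := cfPressure_antitoneOn hA hne (show (σ₁ : ℝ) ∈ Ici 0 from hσ₁0) (show (δ : ℝ) ∈ Ici 0 from hδ0.le) hσ₁δ.le
    rw [hPδ] at this; exact this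
  have hp8 : 8 * p ≤ ℓ := by
    have hlip := abs_cfPressure_sub_le hA hne hBmax hδ0.le hσ₁0
    rw [hPδ, sub_zero] at hlip
    have h1 : p ≤ Lp * (μ / 2) := by
      have : |σ₁ - δ| = μ / 2 := by rw [hσ₁, show δ - μ / 2 - δ = -(μ / 2) by ring, abs_neg, abs_of_pos (by positivity)]
      rw [this] at hlip
      exact (le_abs_self _).trans hlip
    have h2' : Lp * (μ / 2) ≤ Lp * τ := by nlinarith
    have h3 : Lp * τ ≤ ℓ / 8 := by
      rw [hτ, mul_div_assoc', div_le_div_iff₀ (by positivity) (by norm_num)]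
      nlinarith
    linarith
  -- Theorem 4 (2) data at level `1`
  have hT2 : ∀ s : ℂ, |s.re - δ| < ε → b₀ < |s.im| → ∀ F : ℝ → CfVec 1, ContDiffOn ℝ 1 F (cfI A) →
      ∀ m : ℕ, c1NormOn (cfI A) ((cfCongL A 1 ((s.re : ℂ) + s.im * I))^[m] F) ≤
        Cη * |s.im| ^ (1 + (1 : ℝ)) * ρ ^ m * c1NormOn (cfI A) F :=
    fun s hs hb => hmain s.re s.im hs hb
  have hsdec : ∀ s : ℂ, s = (s.re : ℂ) + s.im * I := fun s => (re_add_im s).symm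
  -- (hL1), (hL2)
  have hL12 : ∀ s : ℂ, σ₀ < s.re → IsUnit (1 + cfLOp A hA s) ∧ (s ≠ (δ : ℂ) → IsUnit (1 - cfLOp A hA s)) := by
    intro s hs
    by_cases hre : δ ≤ s.re
    · exact ⟨isUnit_one_add_cfLOp A hA h2 hre, fun hne' => isUnit_one_sub_cfLOp A hA h2 hre hne'⟩
    · have hre' : s.re < δ := not_le.1 hre
      have habs : |s.re - δ| < ε := by rw [abs_sub_comm, abs_of_pos (by linarith)]; rw [hσ₀] at hs; linarith
      by_cases hb : |s.im| ≤ b₀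
      · have h := hunits s (by rw [hσ₀] at hs; linarith) hb
        exact ⟨h.1, h.2⟩
      · have hb' : b₀ < |s.im| := not_le.1 hb
        have hs0 : 0 ≤ s.re := by linarith
        have hβ := thm4_large_bounds hA (q := 1) hCη.le hρ0.le (hT2 s habs hb')
        have hB0 : ∀ m, 0 ≤ Cη * |s.im| ^ (2 : ℝ) * ρ ^ m := fun m => by positivity
        have hBs : Summable fun m => Cη * |s.im| ^ (2 : ℝ) * ρ ^ m := (summable_geometric_of_lt_one hρ0.le hρ1).mul_left _
        have hs0' : 0 ≤ ((s.re : ℂ) + s.im * I).re := by simpa using hs0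
        obtain ⟨-, hm, hp'⟩ := isUnit_one_sub_cfLOp_of_bounds hA hs0' one_pos hB0 hBs hβ
        rw [← hsdec s] at hm hp'
        exact ⟨hp', fun _ => hm⟩
  have hL1 : ∀ s : ℂ, σ₀ < s.re → s ≠ (cfDimension A : ℂ) → IsUnit (1 - cfLOp A hA s) := fun s hs hne' => (hL12 s hs).2 hne'
  have hL2 : ∀ s : ℂ, σ₀ < s.re → IsUnit (1 + cfLOp A hA s) := fun s hs => (hL12 s hs).1
  -- (hB) at level `1`: trivial
  have hB : ∀ s : ℂ, σ₀ < s.re → IsUnit (1 - cfTwB A hA 1 s) := fun s _ => isUnit_one_sub_cfTwB_levelOne hA s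
  -- constants for (hop)
  set lamS : ℝ := cfEig A (δ + ε / 2) with hlamS
  have hlamS1 : lamS < 1 := cfEig_lt_one_of_lt A hA h2 (by rw [← hδ]; linarith)
  have hlamS0 : 0 < lamS := cfEig_pos _
  set E : ℝ := 2 * Real.exp (2 * (δ + 1)) * (δ + 2) + 1 with hE
  have hE0 : 0 ≤ E := by positivity
  set Kres : ℝ := ‖((((2 * cfInt (cfNuδ A hA h2) (cfG A hA h2) : ℝ)) : ℂ))⁻¹‖ * ‖cfPi A hA h2‖ with hKres
  have hKres0 : 0 ≤ Kres := by positivity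
  have hResle : ‖cfTwResOp A hA h2 1‖ ≤ Kres := norm_cfTwResOp_le hA h2 (q := 1)
  have hgap0 : 0 ≤ (1 - lamS ^ 2)⁻¹ := inv_nonneg.2 (by nlinarith)
  have hρinv : 0 ≤ (1 - ρ)⁻¹ := inv_nonneg.2 (by linarith)
  have hℓinv : 0 ≤ 1 + 8 / ℓ := by positivity
  have hKfar0 : 0 ≤ ((4 : ℝ) ^ (δ + 1) * (1 - lamS ^ 2)⁻¹ + (ε / 2)⁻¹ * Kres) * E := by positivity
  have hH0 : 0 ≤ (1 + 8 / ℓ) * Real.exp (2 * p) := by positivity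
  have hcA : 0 ≤ (A.card : ℝ) := Nat.cast_nonneg _
  have h4pos : 0 ≤ (4 : ℝ) ^ (δ + 1) := by positivity
  have hKbig0 : 0 ≤ (1 + (A.card : ℝ) ^ 2 + (A.card : ℝ) ^ 4 * ((4 : ℝ) ^ (δ + 1) * ((1 + 8 / ℓ) * Real.exp (2 * p)) +
      2 * Cη ^ 2 * (1 - ρ)⁻¹ * E)) + b₀⁻¹ * Kres * E :=
    add_nonneg (add_nonneg (add_nonneg zero_le_one (pow_nonneg hcA 2)) (mul_nonneg (pow_nonneg hcA 4)
      (add_nonneg (mul_nonneg h4pos hH0) (mul_nonneg (mul_nonneg (mul_nonneg zero_le_two (sq_nonneg _)) hρinv) hE0))))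
      (mul_nonneg (mul_nonneg (inv_nonneg.2 hb₀.le) hKres0) hE0)
  have h2inv : 0 ≤ (1 - (1 / 2 : ℝ))⁻¹ := by norm_num
  have hKsmall0 : 0 ≤ MX * E + 2 + 2 * (A.card : ℝ) ^ 2 + 2 * (A.card : ℝ) ^ 4 * 1 * (1 - (1 / 2 : ℝ))⁻¹ * E :=
    add_nonneg (add_nonneg (add_nonneg (mul_nonneg hMX hE0) zero_le_two) (mul_nonneg zero_le_two (pow_nonneg hcA 2)))
      (mul_nonneg (mul_nonneg (mul_nonneg (mul_nonneg zero_le_two (pow_nonneg hcA 4)) zero_le_one) h2inv) hE0)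
  set Kfar : ℝ := ((4 : ℝ) ^ (δ + 1) * (1 - lamS ^ 2)⁻¹ + (ε / 2)⁻¹ * Kres) * E with hKfar
  set H : ℝ := (1 + 8 / ℓ) * Real.exp (2 * p) with hH
  set Kbig : ℝ := (1 + (A.card : ℝ) ^ 2 + (A.card : ℝ) ^ 4 * ((4 : ℝ) ^ (δ + 1) * H + 2 * Cη ^ 2 * (1 - ρ)⁻¹ * E)) +
    b₀⁻¹ * Kres * E with hKbig
  set Ksmall : ℝ := MX * E + 2 + 2 * (A.card : ℝ) ^ 2 + 2 * (A.card : ℝ) ^ 4 * 1 * (1 - (1 / 2 : ℝ))⁻¹ * E with hKsmall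
  have hKc0 : 0 ≤ Kfar + Kbig + Ksmall := add_nonneg (add_nonneg hKfar0 hKbig0) hKsmall0
  set Kc : ℝ := Kfar + Kbig + Ksmall with hKc
  have hone2 : (((1 : ℕ) : ℝ)) ^ 2 = 1 := by norm_num
  have hone3 : (((1 : ℕ) : ℝ)) ^ ((1 : ℝ) + 2) = 1 := by rw [Nat.cast_one, Real.one_rpow]
  -- (hop) at level `1`
  have hop : ∀ u : ℝ, σ₁ ≤ u → u ≤ cfDimension A + 1 → ∀ t : ℝ,
      (u : ℂ) + t * I ≠ (cfDimension A : ℂ) → ∀ (η : SL(2, ZMod 1)) (y : Icc (0 : ℝ) 1),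
        ‖(cfTwHop A hA h2 1 ((u : ℂ) + t * I) (cfFamS 1 cfΘ₀ (CfLip.const 1) 1 ((u : ℂ) + t * I))) η y‖ ≤
          Kc * (1 + |t|) ^ (3 / 2 : ℝ) := by
    intro u hσu hu1 t hne' η y
    have hu0 : 0 ≤ u := hσ₁0.trans hσu
    set T : ℝ := 1 + |t| with hTdef
    have hT1 : 1 ≤ T := by rw [hTdef]; linarith [abs_nonneg t]
    have hT32 : T ≤ T ^ (3 / 2 : ℝ) := by
      have := Real.rpow_le_rpow_of_exponent_le hT1 (show (1 : ℝ) ≤ 3 / 2 by norm_num); rwa [Real.rpow_one] at this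
    have hT320 : 0 ≤ T ^ (3 / 2 : ℝ) := by positivity
    have hfinal : ∀ {v K : ℝ}, v ≤ K * T ^ (3 / 2 : ℝ) → 0 ≤ K → K ≤ Kc → v ≤ Kc * (1 + |t|) ^ (3 / 2 : ℝ) := by
      intro v K hv hK hKle
      exact hv.trans (mul_le_mul_of_nonneg_right hKle hT320)
    by_cases hfar : δ + ε / 2 ≤ u
    · have h := hop_bound_far hA h2 (q := 1) hε hfar hu1 (t := t) η y
      refine hfinal (K := Kfar) (h.trans ?_) hKfar0 (by rw [hKc]; linarith)
      have hc : ((4 : ℝ) ^ (δ + 1) * (1 - lamS ^ 2)⁻¹ + (ε / 2)⁻¹ * ‖cfTwResOp A hA h2 1‖) ≤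
          ((4 : ℝ) ^ (δ + 1) * (1 - lamS ^ 2)⁻¹ + (ε / 2)⁻¹ * Kres) :=
        add_le_add le_rfl (mul_le_mul_of_nonneg_left hResle (by positivity))
      calc _ ≤ ((4 : ℝ) ^ (δ + 1) * (1 - lamS ^ 2)⁻¹ + (ε / 2)⁻¹ * Kres) * (E * T) :=
            mul_le_mul_of_nonneg_right hc (by positivity)
        _ = Kfar * T := by rw [hKfar]; ring
        _ ≤ Kfar * T ^ (3 / 2 : ℝ) := mul_le_mul_of_nonneg_left hT32 hKfar0
    · have hu' : u < δ + ε / 2 := not_le.1 hfar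
      have habs : |u - δ| < ε := by
        have h1 : δ - ε / 2 < u := by have := hσu; rw [hσ₁] at this; linarith
        rw [abs_lt]; constructor <;> linarith
      by_cases hb : b₀ < |t|
      · have hT := hmain u t habs hb
        have h := hop_bound_bigT hA h2 (q := 1) hb₀ hCη.le hρ0 hρ1 hp0 hp8 hσ₁0 rfl hσu hu1 hb hT η y
        rw [hone2, mul_one] at h
        refine hfinal (K := Kbig) (h.trans ?_) hKbig0 (by rw [hKc]; linarith)
        have hc : (1 + (A.card : ℝ) ^ 2 + (A.card : ℝ) ^ 4 * ((4 : ℝ) ^ (δ + 1) * H + 2 * Cη ^ 2 * (1 - ρ)⁻¹ * E)) +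
            b₀⁻¹ * ‖cfTwResOp A hA h2 1‖ * E ≤ Kbig := by
          rw [hKbig]
          have := mul_le_mul_of_nonneg_left hResle (by positivity : (0:ℝ) ≤ b₀⁻¹)
          nlinarith [hE0]
        exact mul_le_mul_of_nonneg_right hc hT320
      · have ht : |t| ≤ b₀ := not_lt.1 hb
        have hsu : δ - ε₁ ≤ ((u : ℂ) + t * I).re := by
          have h1 : ((u : ℂ) + t * I).re = u := by simp
          rw [h1]; have := hσu; rw [hσ₁] at this; linarith
        have him : |((u : ℂ) + t * I).im| ≤ b₀ := by
          have h1 : ((u : ℂ) + t * I).im = t := by simp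
          rw [h1]; exact ht
        have hre1 : ((u : ℂ) + t * I).re ≤ δ + 1 := by
          have h1 : ((u : ℂ) + t * I).re = u := by simp
          rw [h1]; exact hu1
        obtain ⟨-, -, hLu, hXb⟩ := hstrip ((u : ℂ) + t * I) hsu hre1 him hne'
        have h := hop_bound_smallT hA h2 (q := 1) (C := 1) (ρ₀ := 1 / 2) zero_le_one (by norm_num) (by norm_num) hMX hu0 hu1
          hLu hXb (thm4_part1_levelOne hA _ zero_le_one (by norm_num)) η y
        rw [hone3, mul_one] at h
        refine hfinal (K := Ksmall) (h.trans ?_) hKsmall0 (by rw [hKc]; linarith)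
        calc Ksmall * (1 + |t|) = Ksmall * T := by rw [hTdef]
          _ ≤ Ksmall * T ^ (3 / 2 : ℝ) := mul_le_mul_of_nonneg_left hT32 hKsmall0
  -- the level-`1` power saving
  obtain ⟨c, hc, -, hbound⟩ := abs_cfCount_sub_le_of_operatorBound_coprime hA h2 ha₀ hb₁ (q := 1)
    (Nat.coprime_one_left 6) isCoprime_one_right hσ₀0 hσ₀₁ hσ₁δ hL1 hL2 hB (κ := 3 / 2) (M := Kc)
    (by norm_num) (by norm_num) hKc0 hop
  have hK : 0 ≤ cfPSConst A hA h2 σ₁ (3 / 2) Kc := by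
    rw [cfPSConst_eq_affine A hA h2 σ₁ (3 / 2) Kc]
    exact add_nonneg (cfPSConst_zero_nonneg A hA h2 (κ := 3 / 2) hσ₁pos) (mul_nonneg hKc0 (cfPSSlope_nonneg A hσ₁pos))
  refine ⟨c, hc, cfPSExp A σ₁, cfPSExp_pos A hA h2 hσ₁δ, cfPSConst A hA h2 σ₁ (3 / 2) Kc, hK, fun R hR => ?_⟩
  have h := hbound 1 R hR
  have hcard : (Fintype.card (SL(2, ZMod 1)) : ℝ) = 1 := by
    rw [Fintype.card_eq_one_iff.2 ⟨1, fun ξ => Subsingleton.elim _ _⟩, Nat.cast_one]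
  rwa [hcard, div_one] at h

end LevelOne

end Literature.NumberTheory.Sieve
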